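import Literature.NumberTheory.NumberFields.CyclicQuinticField2651K3Units
import Literature.NumberTheory.NumberFields.SelmerGroupOddClass
import Literature.NumberTheory.EllipticCurves.TwoDescentParity
import HarnessLib

/-!
# The cyclic quintic field of conductor `2651`, number `3`: `𝓞 K/4`, the finite checks, and the norm-`1` `2`-descent of `480a1`

## Part 1: the quotient `𝓞 K/4` and the finite checks

Continuation of `CyclicQuinticField2651K3Units.lean` (`K = CyclicQuintic2651K3.K`, `(2)` inert, units
`rep n` modulo squares). As in the tree's `CyclicQuinticField11Model.lean`, the `2`-adic part of the
`2`-descent of `480a1 : y² = x(x+2)(x-3)` over `K` only needs the finite ring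
**`Q4 = 𝓞 K/4 = TAlg spec (ℤ/4)`** (the reduction `red4 : 𝓞 K → Q4` of the Units file) and three
finite checks, evaluated by the kernel:

* `oddSq4`/`sq4`: the `31` squares of units and the `32` squares of `Q4`, complete (`sq_mem_oddSq4`,
  `sq_mem_sq4`, by `decide` over the `1024` elements); `IsOdd u ↔ red42 u ≠ 0`; `isOdd_of_not_two_dvd`;
* `repQ n` (the image of `rep n`: products of the reductions `redvTab i` of `σⁱ v`), `repQinv n`,
  the fifteen candidates `candN` (non-zero `n` with even weight (`N v = -1`): the non-trivial unit classes of norm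
  `+1`), `mem_candN`;
* `closure_check`, `cand_check`, `main_check` and their propositional forms `no_solution_neg`
  (`uS ≠ S'`) and `no_solution_main` (`uS + 2 = S'`, `uS - 3 = uS''` impossible), verbatim the
  conductor-`11` file. [folklore]

## Part 2: the norm-`1` `2`-descent of `480a1`

For `K = CyclicQuintic2651K3.K` (one of the four conductor-`2651` quintic subfields of the field `F₅` of
[DokchitserDokchitser2011RankModN, proof of Thm. 2]): **if `(x, y) ∈ K²`, `y ≠ 0`, lies on
`y² = x(x+2)(x-3)` and `N_{K/ℚ}(x)`, `N_{K/ℚ}(x+2)` are rational squares, then `x` and `x + 2` are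
squares in `K`** (`normDescent`), and its transport `normDescent_of_root` to any quintic field containing
a root of `f`. Here `2`, `3`, `5` are inert and the argument is VERBATIM that of the tree's
`CyclicQuinticField11Descent.lean`: even valuations (parity lemma + `σ`-invariance of the inert
valuations + norm squares), `x = u A²` / `x + 2 = u' B²` with unit representatives (`Cl(K)[2] = 0`:
`CyclicQuinticField2651K3ClassGroup.classNumber_odd` and the tree's `SelmerGroupOddClass`;
`𝓞ˣ/𝓞ˣ² = {rep n}`: `…Units.lean`), `u' = 1` by the five real places (signs of the conjugates of
`v` from the permutation `π` of the places induced by `σ` and linear interval arithmetic), and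
`u = 1` by the `2`-adic obstruction modulo `4` (Part 1). Everything is PROVED; no facts.

## References

* J. H. Silverman, *The Arithmetic of Elliptic Curves*, 2nd ed., GTM 106 (2009), Ch. X §1,
  Prop. X.1.4, Thm. X.1.1, Example X.1.5. [SilvermanAEC2009]
* T. Dokchitser, V. Dokchitser, *A note on the Mordell–Weil rank modulo n*, J. Number Theory 131
  (2011) 1833–1839, proof of Thm. 2. [DokchitserDokchitser2011RankModN]
-/

/-! ## Part 1: the quotient `𝓞 K/4` and the finite checks -/

noncomputable section

open NumberField

namespace Literature.NumberTheory.NumberFields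

namespace CyclicQuintic2651K3

/-! ### `Q4 = 𝓞 K/4` and oddness -/

/-- **`Q4 = 𝓞 K/4 = R/4R`.** [folklore] -/
abbrev Q4 : Type := TAlg spec (ZMod 4)

/-- `4 = 0` in `Q4`. [folklore] -/
theorem four_eq_zero : (4 : Q4) = 0 := by decide +kernel

/-- **Fast multiplication of `Q4`** (the table reduced modulo `4`, zero entries dropped), for kernel
evaluation of the finite checks. [folklore] -/
def mulQ (u v : Q4) : Q4 :=
  ⟨![2 * (u.coef 0 * v.coef 0) + 2 * (u.coef 0 * v.coef 1) + 3 * (u.coef 0 * v.coef 2) + 2 * (u.coef 0 * v.coef 3) + 2 * (u.coef 1 * v.coef 0) + 2 * (u.coef 1 * v.coef 1) + (u.coef 1 * v.coef 2) + 2 * (u.coef 1 * v.coef 3) + (u.coef 1 * v.coef 4) + 3 * (u.coef 2 * v.coef 0) + (u.coef 2 * v.coef 1) + 2 * (u.coef 2 * v.coef 3) + 2 * (u.coef 2 * v.coef 4) + 2 * (u.coef 3 * v.coef 0) + 2 * (u.coef 3 * v.coef 1) + 2 * (u.coef 3 * v.coef 2) + (u.coef 3 * v.coef 3) + (u.coef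 3 * v.coef 4) + (u.coef 4 * v.coef 1) + 2 * (u.coef 4 * v.coef 2) + (u.coef 4 * v.coef 3),
    (u.coef 0 * v.coef 2) + 2 * (u.coef 0 * v.coef 3) + (u.coef 0 * v.coef 4) + 2 * (u.coef 1 * v.coef 1) + 2 * (u.coef 1 * v.coef 2) + 3 * (u.coef 1 * v.coef 3) + 2 * (u.coef 1 * v.coef 4) + (u.coef 2 * v.coef 0) + 2 * (u.coef 2 * v.coef 1) + 2 * (u.coef 2 * v.coef 2) + (u.coef 2 * v.coef 3) + 2 * (u.coef 2 * v.coef 4) + 2 * (u.coef 3 * v.coef 0) + 3 * (u.coef 3 * v.coef 1) + (u.coef 3 * v.coef 2) + 2 * (u.coef 3 * v.coef 4) + (u.coef 4 * v.coef 0) + 2 * (u.coef 4 * v.coef 1) + 2 * (u.coef 4 * v.coef 2) + 2 * (u.coef 4 * v.coef 3) + (u.coef 4 * v.coef 4),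
    (u.coef 0 * v.coef 0) + (u.coef 0 * v.coef 1) + 2 * (u.coef 0 * v.coef 2) + 2 * (u.coef 0 * v.coef 3) + 2 * (u.coef 0 * v.coef 4) + (u.coef 1 * v.coef 0) + (u.coef 1 * v.coef 3) + 2 * (u.coef 1 * v.coef 4) + 2 * (u.coef 2 * v.coef 0) + 2 * (u.coef 2 * v.coef 2) + 2 * (u.coef 2 * v.coef 3) + 3 * (u.coef 2 * v.coef 4) + 2 * (u.coef 3 * v.coef 0) + (u.coef 3 * v.coef 1) + 2 * (u.coef 3 * v.coef 2) + 2 * (u.coef 3 * v.coef 3) + (u.coef 3 * v.coef 4) + 2 * (u.coef 4 * v.coef 0) + 2 * (u.coef 4 * v.coef 1) + 3 * (u.coef 4 * v.coef 2) + (u.coef 4 * v.coef 3),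
    2 * (u.coef 0 * v.coef 1) + 2 * (u.coef 0 * v.coef 2) + 3 * (u.coef 0 * v.coef 3) + (u.coef 0 * v.coef 4) + 2 * (u.coef 1 * v.coef 0) + (u.coef 1 * v.coef 1) + (u.coef 1 * v.coef 2) + 2 * (u.coef 1 * v.coef 3) + 2 * (u.coef 1 * v.coef 4) + 2 * (u.coef 2 * v.coef 0) + (u.coef 2 * v.coef 1) + (u.coef 2 * v.coef 4) + 3 * (u.coef 3 * v.coef 0) + 2 * (u.coef 3 * v.coef 1) + 2 * (u.coef 3 * v.coef 3) + 2 * (u.coef 3 * v.coef 4) + (u.coef 4 * v.coef 0) + 2 * (u.coef 4 * v.coef 1) + (u.coef 4 * v.coef 2) + 2 * (u.coef 4 * v.coef 3) + 2 * (u.coef 4 * v.coef 4),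
    2 * (u.coef 0 * v.coef 0) + (u.coef 0 * v.coef 1) + 2 * (u.coef 0 * v.coef 2) + (u.coef 0 * v.coef 3) + 2 * (u.coef 0 * v.coef 4) + (u.coef 1 * v.coef 0) + 2 * (u.coef 1 * v.coef 2) + 2 * (u.coef 1 * v.coef 3) + 3 * (u.coef 1 * v.coef 4) + 2 * (u.coef 2 * v.coef 0) + 2 * (u.coef 2 * v.coef 1) + (u.coef 2 * v.coef 2) + (u.coef 2 * v.coef 3) + 2 * (u.coef 2 * v.coef 4) + (u.coef 3 * v.coef 0) + 2 * (u.coef 3 * v.coef 1) + (u.coef 3 * v.coef 2) + 2 * (u.coef 4 * v.coef 0) + 3 * (u.coef 4 * v.coef 1) + 2 * (u.coef 4 * v.coef 2) + 2 * (u.coef 4 * v.coef 4)]⟩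

/-- `mulQ` is the multiplication of `Q4`. [folklore] -/
theorem mulQ_eq (u v : Q4) : mulQ u v = u * v := by
  ext d
  rw [TAlg.mul_coef]
  fin_cases d <;>
  · simp only [mulQ, spec, Fin.sum_univ_five, Fin.isValue, Matrix.cons_val_zero, Matrix.cons_val_one, Matrix.head_cons,
      Matrix.cons_val_two, Matrix.tail_cons, Matrix.cons_val_three, Matrix.cons_val_four,
      Fin.zero_eta, Fin.mk_one, Fin.reduceFinMk, show ((-118 : ℤ) : ZMod 4) = 2 by decide, show ((-113 : ℤ) : ZMod 4) = 3 by decide, show ((-110 : ℤ) : ZMod 4) = 2 by decide, show ((-104 : ℤ) : ZMod 4) = 0 by decide, show ((-99 : ℤ) : ZMod 4) = 1 by decide, show ((-98 : ℤ) : ZMod 4) = 2 by decide, show ((412 : ℤ) : ZMod 4) = 0 by decide, show ((417 : ℤ) : ZMod 4) = 1 by decide, show ((426 : ℤ) : ZMod 4) = 2 by decide, show ((432 : ℤ) : ZMod 4) = 0 by decide, show ((434 : ℤ) : ZMod 4) = 2 by decide]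
    ring

/-- `x³⁰` by repeated squaring with `mulQ`. [folklore] -/
def powQ30 (x : Q4) : Q4 :=
  let x2 := mulQ x x
  let x4 := mulQ x2 x2
  let x8 := mulQ x4 x4
  let x16 := mulQ x8 x8
  mulQ (mulQ (mulQ x16 x8) x4) x2

/-- `powQ30 x = x³⁰`. [folklore] -/
theorem powQ30_eq (x : Q4) : powQ30 x = x ^ 30 := by
  simp only [powQ30, mulQ_eq]; ring

/-- **Odd elements of `Q4`**: non-zero image in `R/2R = 𝔽₃₂` (these are exactly the units). [folklore] -/
def IsOdd (u : Q4) : Prop := red42 u ≠ 0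

/-- Oddness is decidable. [folklore] -/
instance : DecidablePred IsOdd := fun u => by unfold IsOdd; infer_instance

/-- **Elements of `𝓞 K` not divisible by `2` reduce to odd elements** (the kernel of
`red42 ∘ red4 : 𝓞 K → 𝔽₃₂` is `(2)`). [folklore] -/
theorem isOdd_of_not_two_dvd {z : 𝓞 K} (hz : ¬ (2 : 𝓞 K) ∣ z) : IsOdd (red4 z) := by
  intro h0
  apply hz
  -- `red4 z` reduces to `0` modulo `2`: `red4 z = 2 w`, lift to `𝓞 K`
  obtain ⟨w, hw⟩ := exists_eq_two_mul_of_red42_eq_zero h0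
  -- `integerEquiv.symm z - 2 (lift w) ∈ ker (red 4) = 4R`
  set y := integerEquiv.symm z with hy
  have hz' : z = integerEquiv y := (integerEquiv.apply_symm_apply z).symm
  obtain ⟨w', hw'⟩ : ∃ w' : R, red 4 w' = w := ⟨⟨fun a => ((w.coef a).val : ℤ)⟩, by ext a; simp [red]⟩
  have h4 : red 4 (y - 2 * w') = 0 := by
    rw [map_sub, map_mul, hw', map_ofNat, ← hw]
    show red4 z - red 4 y = 0
    rw [hz', show red4 (integerEquiv y) = red 4 y from red4_liftO y, sub_self]
  obtain ⟨t, ht⟩ := TAlg.exists_eq_natCast_mul_of_map_eq_zero 4 h4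
  refine ⟨integerEquiv (w' + 2 * t), ?_⟩
  rw [hz', ← map_ofNat integerEquiv 2, ← map_mul]
  congr 1
  have : y = 2 * w' + 4 * t := by
    have h' := ht
    push_cast at h'
    linear_combination h'
  rw [this]; ring

/-! ### The squares of `Q4` -/

/-- The `31` squares of odd elements (units) of `Q4`. [folklore] -/
def oddSq4 : List Q4 := [⟨![0, 0, 2, 3, 1]⟩, ⟨![0, 0, 3, 0, 3]⟩, ⟨![0, 1, 0, 2, 2]⟩, ⟨![0, 2, 1, 3, 1]⟩, ⟨![0, 2, 2, 0, 1]⟩, ⟨![0, 2, 3, 1, 0]⟩, ⟨![0, 3, 0, 0, 3]⟩, ⟨![0, 3, 0, 3, 0]⟩, ⟨![0, 3, 1, 2, 1]⟩, ⟨![1, 0, 0, 2, 3]⟩, ⟨![1, 0, 2, 1, 3]⟩, ⟨![1, 0, 2, 2, 0]⟩, ⟨![1, 0, 3, 1, 2]⟩, ⟨![1, 1, 1, 1, 1]⟩, ⟨![1, 1, 2, 1, 3]⟩, ⟨![1, 2, 1, 0, 3]⟩, ⟨![1, 2, 1, 3, 1]⟩, ⟨![1, 3, 1, 0, 2]⟩,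 ⟨![1, 3, 1, 1, 2]⟩, ⟨![2, 0, 1, 0, 2]⟩, ⟨![2, 1, 0, 3, 1]⟩, ⟨![2, 1, 3, 1, 0]⟩, ⟨![2, 1, 3, 1, 1]⟩, ⟨![2, 2, 0, 1, 0]⟩, ⟨![2, 3, 1, 0, 0]⟩, ⟨![3, 0, 0, 3, 0]⟩, ⟨![3, 0, 3, 0, 0]⟩, ⟨![3, 1, 0, 0, 2]⟩, ⟨![3, 1, 0, 2, 1]⟩, ⟨![3, 1, 1, 2, 1]⟩, ⟨![3, 1, 2, 1, 0]⟩]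

/-- The `32` squares of `Q4`. [folklore] -/
def sq4 : List Q4 := [⟨![0, 0, 0, 0, 0]⟩, ⟨![0, 0, 2, 3, 1]⟩, ⟨![0, 0, 3, 0, 3]⟩, ⟨![0, 1, 0, 2, 2]⟩, ⟨![0, 2, 1, 3, 1]⟩, ⟨![0, 2, 2, 0, 1]⟩, ⟨![0, 2, 3, 1, 0]⟩, ⟨![0, 3, 0, 0, 3]⟩, ⟨![0, 3, 0, 3, 0]⟩, ⟨![0, 3, 1, 2, 1]⟩, ⟨![1, 0, 0, 2, 3]⟩, ⟨![1, 0, 2, 1, 3]⟩, ⟨![1, 0, 2, 2, 0]⟩, ⟨![1, 0, 3, 1, 2]⟩, ⟨![1, 1, 1, 1, 1]⟩, ⟨![1, 1, 2, 1, 3]⟩, ⟨![1, 2, 1, 0, 3]⟩, ⟨![1, 2, 1, 3, 1]⟩, ⟨![1, 3, 1, 0, 2]⟩, ⟨![1, 3, 1, 1, 2]⟩, ⟨![2, 0, 1, 0, 2]⟩, ⟨![2, 1, 0, 3, 1]⟩, ⟨![2, 1, 3, 1, 0]⟩, ⟨![2, 1, 3, 1, 1]⟩, ⟨![2, 2, 0,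 1, 0]⟩, ⟨![2, 3, 1, 0, 0]⟩, ⟨![3, 0, 0, 3, 0]⟩, ⟨![3, 0, 3, 0, 0]⟩, ⟨![3, 1, 0, 0, 2]⟩, ⟨![3, 1, 0, 2, 1]⟩, ⟨![3, 1, 1, 2, 1]⟩, ⟨![3, 1, 2, 1, 0]⟩]

set_option maxRecDepth 100000 in
set_option maxHeartbeats 0 in
/-- **The square of an odd element is in `oddSq4`** (kernel computation over `Q4`). [folklore] -/
theorem sq_mem_oddSq4 (u : Q4) (hu : IsOdd u) : u * u ∈ oddSq4 := by
  have h : ∀ u : Q4, IsOdd u → mulQ u u ∈ oddSq4 := by decide +kernel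
  rw [← mulQ_eq]; exact h u hu

set_option maxRecDepth 100000 in
set_option maxHeartbeats 0 in
/-- **Every square of `Q4` is in `sq4`** (kernel computation). [folklore] -/
theorem sq_mem_sq4 (u : Q4) : u * u ∈ sq4 := by
  have h : ∀ u : Q4, mulQ u u ∈ sq4 := by decide +kernel
  rw [← mulQ_eq]; exact h u

/-! ### The images of the units and the candidate classes -/

/-- The reductions of the conjugate units `σⁱ v` modulo `4`. [folklore] -/
def redvTab : Fin 5 → Q4 := ![⟨![3, 1, 0, 3, 1]⟩, ⟨![1, 3, 1, 0, 3]⟩, ⟨![3, 1, 3, 1, 0]⟩, ⟨![0, 3, 1, 3, 1]⟩, ⟨![1, 0, 3, 1, 3]⟩]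

/-- The reductions of the inverses `(σⁱ v)⁻¹` modulo `4`. [folklore] -/
def redvinvTab : Fin 5 → Q4 := ![⟨![0, 1, 3, 2, 0]⟩, ⟨![0, 0, 1, 3, 2]⟩, ⟨![2, 0, 0, 1, 3]⟩, ⟨![3, 2, 0, 0, 1]⟩, ⟨![1, 3, 2, 0, 0]⟩]

/-- `red 4 (shiftⁱ v) = redvTab i` (kernel computation). [folklore] -/
theorem red_shift_iterate_vP : ∀ i : Fin 5, red 4 (shift^[(i : ℕ)] vP) = redvTab i := by
  decide +kernel

/-- The image of `rep n` in `Q4` (explicit product, for kernel evaluation). [folklore] -/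
def repQ (n : Fin 32) : Q4 :=
  (-1) ^ bit n 4 * (redvTab 0 ^ bit n 0 * redvTab 1 ^ bit n 1 * redvTab 2 ^ bit n 2 * redvTab 3 ^ bit n 3)

/-- The image of `(rep n)⁻¹`. [folklore] -/
def repQinv (n : Fin 32) : Q4 :=
  (-1) ^ bit n 4 * (redvinvTab 0 ^ bit n 0 * redvinvTab 1 ^ bit n 1 * redvinvTab 2 ^ bit n 2 * redvinvTab 3 ^ bit n 3)

/-- **`red4 (rep n) = repQ n`.** [folklore] -/
theorem red4_rep (n : Fin 32) : red4 ((rep n : (𝓞 K)ˣ) : 𝓞 K) = repQ n := by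
  rw [rep, Units.val_mul, Units.val_pow_eq_pow_val, Units.val_neg, Units.val_one, map_mul, map_pow, map_neg, map_one,
    Units.coe_prod, map_prod, repQ, Fin.prod_univ_four]
  simp only [Units.val_pow_eq_pow_val, map_pow, coe_unitv, red4_liftO, Fin.castSucc_zero, Fin.castSucc_one,
    show (Fin.castSucc (2 : Fin 4) : Fin 5) = 2 from rfl, show (Fin.castSucc (3 : Fin 4) : Fin 5) = 3 from rfl,
    red_shift_iterate_vP]

/-- **The fifteen candidates**: the non-zero `n < 32` with even weight (`N v = -1`). [folklore] -/
def candN : List (Fin 32) := [3, 5, 6, 9, 10, 12, 15, 17, 18, 20, 23, 24, 27, 29, 30]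

/-- Every non-zero `n` satisfying the norm condition is a candidate (by computation). [folklore] -/
theorem mem_candN : ∀ n : Fin 32, n ≠ 0 → 2 ∣ bit n 0 + bit n 1 + bit n 2 + bit n 3 + bit n 4 → n ∈ candN := by
  decide +kernel

/-- The weight as a sum over `Fin 5`. [folklore] -/
theorem sum_bit_eq (n : Fin 32) : ∑ i, bit n i = bit n 0 + bit n 1 + bit n 2 + bit n 3 + bit n 4 := by
  rw [Fin.sum_univ_five]

/-! ### The three finite checks -/

set_option maxRecDepth 100000 in
set_option maxHeartbeats 0 in
/-- **`oddSq4` is a group**: closed under products and `S ↦ S³⁰ = S⁻¹` (kernel computation). [folklore] -/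
theorem closure_check :
    (oddSq4.all fun s => (mulQ s (powQ30 s) == 1) && List.elem (powQ30 s) oddSq4 &&
      oddSq4.all fun s' => List.elem (mulQ s s') oddSq4) = true := by
  decide +kernel

set_option maxRecDepth 100000 in
set_option maxHeartbeats 0 in
/-- **No candidate unit is an odd square modulo `4`**, and `repQinv n` is its inverse. [folklore] -/
theorem cand_check :
    (candN.all fun n => (mulQ (repQ n) (repQinv n) == 1) && !(List.elem (repQ n) oddSq4)) = true := by
  decide +kernel

set_option maxRecDepth 100000 in
set_option maxHeartbeats 0 in
/-- **The main check** (case `ord₂(x) = 0`): for `u = repQ n` and `S ∈ oddSq4`, if `uS + 2 ∈ oddSq4`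
then `S - 3u⁻¹ ∉ sq4`. [folklore] -/
theorem main_check :
    (candN.all fun n => oddSq4.all fun s =>
      !(List.elem (mulQ (repQ n) s + 2) oddSq4) || !(List.elem (s - mulQ 3 (repQinv n)) sq4)) = true := by
  decide +kernel

/-! ### Propositional forms -/

/-- `oddSq4` is closed under multiplication. [folklore] -/
theorem mul_mem_oddSq4 {s s' : Q4} (hs : s ∈ oddSq4) (hs' : s' ∈ oddSq4) : s * s' ∈ oddSq4 := by
  have h := closure_check
  simp only [List.all_eq_true, Bool.and_eq_true] at h
  rw [← mulQ_eq]
  exact List.mem_of_elem_eq_true ((h s hs).2 s' hs')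

/-- Inverses in `oddSq4`. [folklore] -/
theorem inv_mem_oddSq4 {s : Q4} (hs : s ∈ oddSq4) : s * s ^ 30 = 1 ∧ s ^ 30 ∈ oddSq4 := by
  have h := closure_check
  simp only [List.all_eq_true, Bool.and_eq_true, beq_iff_eq] at h
  rw [← powQ30_eq, ← mulQ_eq]
  exact ⟨(h s hs).1.1, List.mem_of_elem_eq_true (h s hs).1.2⟩

/-- For a candidate `n`: `repQ n · repQinv n = 1` and `repQ n ∉ oddSq4`. [folklore] -/
theorem cand_spec {n : Fin 32} (hn : n ∈ candN) : repQ n * repQinv n = 1 ∧ repQ n ∉ oddSq4 := by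
  have h := cand_check
  simp only [List.all_eq_true, Bool.and_eq_true, beq_iff_eq, Bool.not_eq_true'] at h
  rw [← mulQ_eq]
  refine ⟨(h n hn).1, fun hmem => ?_⟩
  have := List.elem_eq_true_of_mem hmem
  rw [(h n hn).2] at this
  exact Bool.false_ne_true this

/-- **Case `ord₂(x) < 0`**: `u · S ≠ S'` for a candidate `u` and odd squares `S, S'`. [folklore] -/
theorem no_solution_neg {n : Fin 32} (hn : n ∈ candN) {S S' : Q4} (hS : S ∈ oddSq4) (hS' : S' ∈ oddSq4) :
    repQ n * S ≠ S' := by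
  intro h
  obtain ⟨hinv, hmem⟩ := inv_mem_oddSq4 hS
  apply (cand_spec hn).2
  have e : repQ n = S' * S ^ 30 := by
    calc repQ n = repQ n * (S * S ^ 30) := by rw [hinv, mul_one]
      _ = repQ n * S * S ^ 30 := by ring
      _ = S' * S ^ 30 := by rw [h]
  rw [e]
  exact mul_mem_oddSq4 hS' hmem

/-- **Case `ord₂(x) = 0`**: `uS + 2 = S'` and `uS - 3 = uS''` have no solution with `S, S'` odd squares
and `S''` a square, for a candidate `u`. [folklore] -/
theorem no_solution_main {n : Fin 32} (hn : n ∈ candN) {S S' S'' : Q4} (hS : S ∈ oddSq4)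
    (hS' : S' ∈ oddSq4) (hS'' : S'' ∈ sq4) (h1 : repQ n * S + 2 = S')
    (h2 : repQ n * S - 3 = repQ n * S'') : False := by
  have h := main_check
  simp only [List.all_eq_true, Bool.or_eq_true, Bool.not_eq_true', mulQ_eq] at h
  have hinv := (cand_spec hn).1
  rcases h n hn S hS with h' | h'
  · have := List.elem_eq_true_of_mem (h1 ▸ hS' : repQ n * S + 2 ∈ oddSq4)
    rw [h'] at this
    exact Bool.false_ne_true this
  · have e : S - 3 * repQinv n = S'' := by
      calc S - 3 * repQinv n = repQinv n * repQ n * S - 3 * repQinv n := by rw [mul_comm (repQinv n), hinv, one_mul]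
        _ = repQinv n * (repQ n * S - 3) := by ring
        _ = repQinv n * (repQ n * S'') := by rw [h2]
        _ = repQinv n * repQ n * S'' := by ring
        _ = S'' := by rw [mul_comm (repQinv n), hinv, one_mul]
    have := List.elem_eq_true_of_mem (e ▸ hS'' : S - 3 * repQinv n ∈ sq4)
    rw [h'] at this
    exact Bool.false_ne_true this

end CyclicQuintic2651K3

end Literature.NumberTheory.NumberFields

end

/-! ## Part 2: the norm-`1` `2`-descent of `480a1` -/

noncomputable section

open Polynomial NumberField Algebra Ideal IsDedekindDomain IsDedekindDomain.HeightOneSpectrum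
open scoped WithZero

namespace Literature.NumberTheory.NumberFields

namespace CyclicQuintic2651K3



/-- `Q2 = R/2R = 𝔽₃₂`. [folklore] -/
abbrev Q2 : Type := TAlg spec (ZMod 2)

/-! ### The inert places `(2)`, `(3)`, `(5)` as points of `HeightOneSpectrum` -/

/-- **The prime `v₂ = (2)`.** [folklore] -/
def v₂ : HeightOneSpectrum (𝓞 K) := ⟨span {(2 : 𝓞 K)}, span_two.1.isPrime, by
  rw [Ne, span_singleton_eq_bot]; norm_num⟩

/-- **The prime `v₃ = (3)`.** [folklore] -/
def v₃ : HeightOneSpectrum (𝓞 K) := ⟨span {(3 : 𝓞 K)}, span_three.1.isPrime, by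
  rw [Ne, span_singleton_eq_bot]; norm_num⟩

/-- **The prime `v₅ = (5)`.** [folklore] -/
def v₅ : HeightOneSpectrum (𝓞 K) := ⟨span {(5 : 𝓞 K)}, span_five.1.isPrime, by
  rw [Ne, span_singleton_eq_bot]; norm_num⟩

/-- A point of the height-one spectrum containing `2` is `v₂`. [folklore] -/
theorem eq_v₂_of_mem {v : HeightOneSpectrum (𝓞 K)} (h : (2 : 𝓞 K) ∈ v.asIdeal) : v = v₂ :=
  HeightOneSpectrum.ext (span_two.2 v.asIdeal v.isPrime (by exact_mod_cast h))

/-- A point of the height-one spectrum containing `3` is `v₃`. [folklore] -/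
theorem eq_v₃_of_mem {v : HeightOneSpectrum (𝓞 K)} (h : (3 : 𝓞 K) ∈ v.asIdeal) : v = v₃ :=
  HeightOneSpectrum.ext (span_three.2 v.asIdeal v.isPrime (by exact_mod_cast h))

/-- A point of the height-one spectrum containing `5` is `v₅`. [folklore] -/
theorem eq_v₅_of_mem {v : HeightOneSpectrum (𝓞 K)} (h : (5 : 𝓞 K) ∈ v.asIdeal) : v = v₅ :=
  HeightOneSpectrum.ext (span_five.2 v.asIdeal v.isPrime (by exact_mod_cast h))

/-- **Valuations of rational integers**: `v(n) = 1` unless `n ∈ v`. [folklore] -/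
theorem valuation_natCast_eq_one_iff (v : HeightOneSpectrum (𝓞 K)) (n : ℕ) :
    v.valuation K (n : K) = 1 ↔ (n : 𝓞 K) ∉ v.asIdeal := by
  rw [show (n : K) = algebraMap (𝓞 K) K n by simp, valuation_of_algebraMap, intValuation_eq_one_iff]

/-- `v(n) ≤ 1` for a natural number `n`. [folklore] -/
theorem valuation_natCast_le_one (v : HeightOneSpectrum (𝓞 K)) (n : ℕ) : v.valuation K (n : K) ≤ 1 := by
  rw [show (n : K) = algebraMap (𝓞 K) K n by simp]; exact valuation_le_one v _
/-! ### The invariance of the inert valuations under `σ`; norm parity -/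

/-- **A ring automorphism of `𝓞 K` does not increase the valuation at an inert prime `(p)`**: it
preserves divisibility by `pⁿ`. (Verbatim the tree's `CyclicCubic13.intValuation_ringEquiv_le`.)
[folklore] -/
theorem intValuation_ringEquiv_le (v : HeightOneSpectrum (𝓞 K)) {p : ℕ} (hv : v.asIdeal = span {(p : 𝓞 K)})
    (τ : 𝓞 K ≃+* 𝓞 K) (a : 𝓞 K) : v.intValuation (τ a) ≤ v.intValuation a := by
  by_cases ha : a = 0
  · simp [ha]
  have key : ∀ (b : 𝓞 K) (n : ℕ), v.intValuation b ≤ WithZero.exp (-(n : ℤ)) ↔ (p : 𝓞 K) ^ n ∣ b := by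
    intro b n
    rw [intValuation_le_pow_iff_dvd, hv, Ideal.span_singleton_pow, dvd_span_singleton,
      Ideal.mem_span_singleton]
  have hva : v.intValuation a ≠ 0 := intValuation_ne_zero v a ha
  obtain ⟨m, hm⟩ : ∃ m : ℕ, v.intValuation a = WithZero.exp (-(m : ℤ)) := by
    have hle : WithZero.log (v.intValuation a) ≤ 0 := by
      rw [← WithZero.log_one]
      exact (WithZero.log_le_log hva one_ne_zero).mpr (intValuation_le_one v a)
    refine ⟨(-WithZero.log (v.intValuation a)).toNat, ?_⟩
    rw [Int.toNat_of_nonneg (by omega), neg_neg, WithZero.exp_log hva]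
  rw [hm, key]
  have h := (key a m).mp hm.le
  simpa using map_dvd τ h

/-- Hence `v_{(p)}(τ a) = v_{(p)}(a)` for a ring automorphism `τ` of `𝓞 K` and an inert `p`.
[folklore] -/
theorem intValuation_ringEquiv_eq (v : HeightOneSpectrum (𝓞 K)) {p : ℕ} (hv : v.asIdeal = span {(p : 𝓞 K)})
    (τ : 𝓞 K ≃+* 𝓞 K) (a : 𝓞 K) : v.intValuation (τ a) = v.intValuation a := by
  refine le_antisymm (intValuation_ringEquiv_le v hv τ a) ?_
  have := intValuation_ringEquiv_le v hv τ.symm (τ a)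
  rwa [τ.symm_apply_apply] at this

/-- **`σ` preserves the valuation of `K` at an inert prime `(p)`.** [folklore] -/
theorem valuation_σ_eq (v : HeightOneSpectrum (𝓞 K)) {p : ℕ} (hv : v.asIdeal = span {(p : 𝓞 K)}) (z : K) :
    v.valuation K (σ z) = v.valuation K z := by
  obtain ⟨a, b, hb, rfl⟩ := IsFractionRing.div_surjective (A := 𝓞 K) z
  have e : σ (algebraMap (𝓞 K) K a / algebraMap (𝓞 K) K b) =
      algebraMap (𝓞 K) K (σint a) / algebraMap (𝓞 K) K (σint b) := by
    rw [map_div₀]; rfl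
  rw [e, map_div₀, map_div₀, valuation_of_algebraMap, valuation_of_algebraMap, valuation_of_algebraMap,
    valuation_of_algebraMap, intValuation_ringEquiv_eq v hv, intValuation_ringEquiv_eq v hv]

/-- The same for the iterates `σⁱ`. [folklore] -/
theorem valuation_σ_iterate_eq (v : HeightOneSpectrum (𝓞 K)) {p : ℕ} (hv : v.asIdeal = span {(p : 𝓞 K)})
    (n : ℕ) (z : K) : v.valuation K (σ^[n] z) = v.valuation K z := by
  induction n with
  | zero => rfl
  | succ n ih => rw [Function.iterate_succ_apply', valuation_σ_eq v hv, ih]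

/-- **Norm parity at an inert prime**: if `N_{K/ℚ}(z)` is the square of a rational number then
`ord_{(p)}(z)` is even, for `p = 2, 3, 5` inert in `K`: `N(z) = ∏_{i<5} σⁱz` has
`ord_{(p)}(N z) = 5 ord_{(p)}(z)` and `ord_{(p)}(r²) = 2 ord_{(p)}(r)`. [folklore] -/
theorem two_dvd_log_valuation_of_isSquare_norm (v : HeightOneSpectrum (𝓞 K)) {p : ℕ}
    (hv : v.asIdeal = span {(p : 𝓞 K)}) {z : K} (hz : z ≠ 0) (h : IsSquare (Algebra.norm ℚ z)) :
    (2 : ℤ) ∣ WithZero.log (v.valuation K z) := by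
  obtain ⟨r, hr⟩ := h
  have hN := norm_eq_prod_pow_σ z
  rw [hr, map_mul] at hN
  set w := v.valuation K with hw
  have hσz : ∀ i : Fin 5, (σ ^ (i : ℕ)) z ≠ 0 := fun i => (_root_.map_ne_zero _).mpr hz
  have hprod : ∏ i : Fin 5, (σ ^ (i : ℕ)) z ≠ 0 := Finset.prod_ne_zero_iff.mpr fun i _ => hσz i
  have hr0 : (algebraMap ℚ K r) ≠ 0 := by
    intro h0
    rw [h0, zero_mul] at hN
    exact hprod hN.symm
  have hv0 : w z ≠ 0 := (Valuation.ne_zero_iff _).mpr hz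
  have hvr : w (algebraMap ℚ K r) ≠ 0 := (Valuation.ne_zero_iff _).mpr hr0
  have hwi : ∀ i : Fin 5, w ((σ ^ (i : ℕ)) z) = w z := fun i => by
    rw [hw, σ_pow_apply, valuation_σ_iterate_eq v hv]
  have key : WithZero.log (w (algebraMap ℚ K r * algebraMap ℚ K r)) =
      WithZero.log (w (∏ i : Fin 5, (σ ^ (i : ℕ)) z)) := by rw [hN]
  rw [map_mul, WithZero.log_mul hvr hvr, map_prod] at key
  simp_rw [hwi] at key
  rw [Finset.prod_const, Finset.card_univ, Fintype.card_fin, WithZero.log_pow] at key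
  exact ⟨3 * WithZero.log (w z) - WithZero.log (w (algebraMap ℚ K r)), by
    simp only [nsmul_eq_mul, Nat.cast_ofNat] at key; linarith⟩

/-! ### The real places: `x + 2` is totally positive -/

/-- **On the real curve `Y² = X(X+2)(X-3)` with `Y ≠ 0` one has `X + 2 > 0`** (the cubic is positive
exactly on `(-2, 0) ∪ (3, ∞)`). (Verbatim the tree's `CyclicCubic13.real_x_add_two_pos`.) [folklore] -/
theorem real_x_add_two_pos {X Y : ℝ} (h : Y ^ 2 = X * (X + 2) * (X - 3)) (hY : Y ≠ 0) : 0 < X + 2 := by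
  by_contra hle
  rw [not_lt] at hle
  have hX : X ≤ -2 := by linarith
  have h1 : 0 < X * (X - 3) := by nlinarith
  have h2 : X * (X + 2) * (X - 3) = (X + 2) * (X * (X - 3)) := by ring
  have h3 : 0 < Y ^ 2 := lt_of_le_of_ne (sq_nonneg Y) (Ne.symm (pow_ne_zero 2 hY))
  nlinarith

/-- **`x + 2` is positive at every real place** for a `K`-point of `y² = x(x+2)(x-3)` with `y ≠ 0`.
[folklore] -/
theorem emb_x_add_two_pos {x y : K} (hE : y ^ 2 = x * (x + 2) * (x - 3)) (hy : y ≠ 0) (k : Fin 5) :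
    0 < emb k (x + 2) := by
  rw [map_add, map_ofNat]
  refine real_x_add_two_pos (Y := emb k y) ?_ ((_root_.map_ne_zero (emb k)).mpr hy)
  have := congrArg (emb k) hE
  simpa [map_pow, map_mul, map_add, map_sub, map_ofNat] using this

/-! ### `σ` permutes the real places; the signs of the units -/

/-- `emb s (σθ)` is a root of `p`. [folklore] -/
theorem preal_emb_g_one (s : Fin 5) : preal (emb s (g 1)) = 0 := by
  have h := congrArg (emb s) aeval_g_one
  rw [map_zero, aeval_def, Polynomial.hom_eval₂, RingHom.ext_rat ((emb s).comp (algebraMap ℚ K)) (algebraMap ℚ ℝ),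
    eval₂_quinticPolyRat_eq_preal] at h
  exact h

/-- `emb s (σθ) = P₁(r s)/D`. [folklore] -/
theorem emb_g_one_eq_div (s : Fin 5) : emb s (g 1) = ((59840844 : ℝ) + (-8768069 : ℝ) * r s + (-21104 : ℝ) * r s ^ 2 + (19875 : ℝ) * r s ^ 3 + (-414 : ℝ) * r s ^ 4) / 1983541 := by
  simp only [g, map_div₀, map_add, map_mul, map_pow, map_neg, map_ofNat, emb_θ]

/-- Powers of a real number in a non-negative interval. [folklore] -/
theorem pow_bounds_pos {lo hi x : ℝ} (h0 : 0 ≤ lo) (h1 : lo < x) (h2 : x < hi) :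
    lo ^ 2 < x ^ 2 ∧ x ^ 2 < hi ^ 2 ∧ lo ^ 3 < x ^ 3 ∧ x ^ 3 < hi ^ 3 ∧ lo ^ 4 < x ^ 4 ∧ x ^ 4 < hi ^ 4 := by
  have hx : 0 ≤ x := h0.trans h1.le
  exact ⟨pow_lt_pow_left₀ h1 h0 two_ne_zero, pow_lt_pow_left₀ h2 hx two_ne_zero,
    pow_lt_pow_left₀ h1 h0 three_ne_zero, pow_lt_pow_left₀ h2 hx three_ne_zero,
    pow_lt_pow_left₀ h1 h0 four_ne_zero, pow_lt_pow_left₀ h2 hx four_ne_zero⟩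

/-- Powers of a real number in a non-positive interval. [folklore] -/
theorem pow_bounds_neg {lo hi x : ℝ} (h0 : hi ≤ 0) (h1 : lo < x) (h2 : x < hi) :
    hi ^ 2 < x ^ 2 ∧ x ^ 2 < lo ^ 2 ∧ lo ^ 3 < x ^ 3 ∧ x ^ 3 < hi ^ 3 ∧ hi ^ 4 < x ^ 4 ∧ x ^ 4 < lo ^ 4 := by
  have hb := pow_bounds_pos (lo := -hi) (hi := -lo) (x := -x) (by linarith) (by linarith) (by linarith)
  simp only [neg_sq, Even.neg_pow (by decide : Even 4), Odd.neg_pow (by decide : Odd 3)] at hb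
  exact ⟨hb.1, hb.2.1, by linarith [hb.2.2.1], by linarith [hb.2.2.2.1], hb.2.2.2.2.1, hb.2.2.2.2.2⟩

/-- `emb 0 (g 1) = r 1` (`σ` permutes the real places). [folklore] -/
theorem emb_g_one_0 : emb 0 (g 1) = r₁ := by
  have hv := emb_g_one_eq_div 0
  have hs := r₀_spec.1
  simp only [Set.mem_Ioo] at hs
  rw [show r 0 = r₀ from rfl] at hv
  have hb := pow_bounds_neg (show (-2125513645 / 100000000 : ℝ) ≤ 0 by norm_num) hs.1 hs.2
  norm_num at hb
  rcases root_cases (preal_emb_g_one 0) with h | h | h | h | h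
  · exfalso
    have hj := r₀_spec.1
    simp only [Set.mem_Ioo] at hj
    rw [h] at hv
    nlinarith [hj.1, hj.2, hb.1, hb.2.1, hb.2.2.1, hb.2.2.2.1, hb.2.2.2.2.1, hb.2.2.2.2.2, hs.1, hs.2]
  · exact h
  · exfalso
    have hj := r₂_spec.1
    simp only [Set.mem_Ioo] at hj
    rw [h] at hv
    nlinarith [hj.1, hj.2, hb.1, hb.2.1, hb.2.2.1, hb.2.2.2.1, hb.2.2.2.2.1, hb.2.2.2.2.2, hs.1, hs.2]
  · exfalso
    have hj := r₃_spec.1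
    simp only [Set.mem_Ioo] at hj
    rw [h] at hv
    nlinarith [hj.1, hj.2, hb.1, hb.2.1, hb.2.2.1, hb.2.2.2.1, hb.2.2.2.2.1, hb.2.2.2.2.2, hs.1, hs.2]
  · exfalso
    have hj := r₄_spec.1
    simp only [Set.mem_Ioo] at hj
    rw [h] at hv
    nlinarith [hj.1, hj.2, hb.1, hb.2.1, hb.2.2.1, hb.2.2.2.1, hb.2.2.2.2.1, hb.2.2.2.2.2, hs.1, hs.2]

/-- `emb 1 (g 1) = r 3` (`σ` permutes the real places). [folklore] -/
theorem emb_g_one_1 : emb 1 (g 1) = r₃ := by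
  have hv := emb_g_one_eq_div 1
  have hs := r₁_spec.1
  simp only [Set.mem_Ioo] at hs
  rw [show r 1 = r₁ from rfl] at hv
  have hb := pow_bounds_neg (show (-1950038503 / 100000000 : ℝ) ≤ 0 by norm_num) hs.1 hs.2
  norm_num at hb
  rcases root_cases (preal_emb_g_one 1) with h | h | h | h | h
  · exfalso
    have hj := r₀_spec.1
    simp only [Set.mem_Ioo] at hj
    rw [h] at hv
    nlinarith [hj.1, hj.2, hb.1, hb.2.1, hb.2.2.1, hb.2.2.2.1, hb.2.2.2.2.1, hb.2.2.2.2.2, hs.1, hs.2]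
  · exfalso
    have hj := r₁_spec.1
    simp only [Set.mem_Ioo] at hj
    rw [h] at hv
    nlinarith [hj.1, hj.2, hb.1, hb.2.1, hb.2.2.1, hb.2.2.2.1, hb.2.2.2.2.1, hb.2.2.2.2.2, hs.1, hs.2]
  · exfalso
    have hj := r₂_spec.1
    simp only [Set.mem_Ioo] at hj
    rw [h] at hv
    nlinarith [hj.1, hj.2, hb.1, hb.2.1, hb.2.2.1, hb.2.2.2.1, hb.2.2.2.2.1, hb.2.2.2.2.2, hs.1, hs.2]
  · exact h
  · exfalso
    have hj := r₄_spec.1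
    simp only [Set.mem_Ioo] at hj
    rw [h] at hv
    nlinarith [hj.1, hj.2, hb.1, hb.2.1, hb.2.2.1, hb.2.2.2.1, hb.2.2.2.2.1, hb.2.2.2.2.2, hs.1, hs.2]

/-- `emb 2 (g 1) = r 4` (`σ` permutes the real places). [folklore] -/
theorem emb_g_one_2 : emb 2 (g 1) = r₄ := by
  have hv := emb_g_one_eq_div 2
  have hs := r₂_spec.1
  simp only [Set.mem_Ioo] at hs
  rw [show r 2 = r₂ from rfl] at hv
  have hb := pow_bounds_neg (show (-110307518 / 100000000 : ℝ) ≤ 0 by norm_num) hs.1 hs.2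
  norm_num at hb
  rcases root_cases (preal_emb_g_one 2) with h | h | h | h | h
  · exfalso
    have hj := r₀_spec.1
    simp only [Set.mem_Ioo] at hj
    rw [h] at hv
    nlinarith [hj.1, hj.2, hb.1, hb.2.1, hb.2.2.1, hb.2.2.2.1, hb.2.2.2.2.1, hb.2.2.2.2.2, hs.1, hs.2]
  · exfalso
    have hj := r₁_spec.1
    simp only [Set.mem_Ioo] at hj
    rw [h] at hv
    nlinarith [hj.1, hj.2, hb.1, hb.2.1, hb.2.2.1, hb.2.2.2.1, hb.2.2.2.2.1, hb.2.2.2.2.2, hs.1, hs.2]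
  · exfalso
    have hj := r₂_spec.1
    simp only [Set.mem_Ioo] at hj
    rw [h] at hv
    nlinarith [hj.1, hj.2, hb.1, hb.2.1, hb.2.2.1, hb.2.2.2.1, hb.2.2.2.2.1, hb.2.2.2.2.2, hs.1, hs.2]
  · exfalso
    have hj := r₃_spec.1
    simp only [Set.mem_Ioo] at hj
    rw [h] at hv
    nlinarith [hj.1, hj.2, hb.1, hb.2.1, hb.2.2.1, hb.2.2.2.1, hb.2.2.2.2.1, hb.2.2.2.2.2, hs.1, hs.2]
  · exact h

/-- `emb 3 (g 1) = r 2` (`σ` permutes the real places). [folklore] -/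
theorem emb_g_one_3 : emb 3 (g 1) = r₂ := by
  have hv := emb_g_one_eq_div 3
  have hs := r₃_spec.1
  simp only [Set.mem_Ioo] at hs
  rw [show r 3 = r₃ from rfl] at hv
  have hb := pow_bounds_pos (show (0:ℝ) ≤ 784055799 / 100000000 by norm_num) hs.1 hs.2
  norm_num at hb
  rcases root_cases (preal_emb_g_one 3) with h | h | h | h | h
  · exfalso
    have hj := r₀_spec.1
    simp only [Set.mem_Ioo] at hj
    rw [h] at hv
    nlinarith [hj.1, hj.2, hb.1, hb.2.1, hb.2.2.1, hb.2.2.2.1, hb.2.2.2.2.1, hb.2.2.2.2.2, hs.1, hs.2]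
  · exfalso
    have hj := r₁_spec.1
    simp only [Set.mem_Ioo] at hj
    rw [h] at hv
    nlinarith [hj.1, hj.2, hb.1, hb.2.1, hb.2.2.1, hb.2.2.2.1, hb.2.2.2.2.1, hb.2.2.2.2.2, hs.1, hs.2]
  · exact h
  · exfalso
    have hj := r₃_spec.1
    simp only [Set.mem_Ioo] at hj
    rw [h] at hv
    nlinarith [hj.1, hj.2, hb.1, hb.2.1, hb.2.2.1, hb.2.2.2.1, hb.2.2.2.2.1, hb.2.2.2.2.2, hs.1, hs.2]
  · exfalso
    have hj := r₄_spec.1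
    simp only [Set.mem_Ioo] at hj
    rw [h] at hv
    nlinarith [hj.1, hj.2, hb.1, hb.2.1, hb.2.2.1, hb.2.2.2.1, hb.2.2.2.2.1, hb.2.2.2.2.2, hs.1, hs.2]

/-- `emb 4 (g 1) = r 0` (`σ` permutes the real places). [folklore] -/
theorem emb_g_one_4 : emb 4 (g 1) = r₀ := by
  have hv := emb_g_one_eq_div 4
  have hs := r₄_spec.1
  simp only [Set.mem_Ioo] at hs
  rw [show r 4 = r₄ from rfl] at hv
  have hb := pow_bounds_pos (show (0:ℝ) ≤ 3501803868 / 100000000 by norm_num) hs.1 hs.2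
  norm_num at hb
  rcases root_cases (preal_emb_g_one 4) with h | h | h | h | h
  · exact h
  · exfalso
    have hj := r₁_spec.1
    simp only [Set.mem_Ioo] at hj
    rw [h] at hv
    nlinarith [hj.1, hj.2, hb.1, hb.2.1, hb.2.2.1, hb.2.2.2.1, hb.2.2.2.2.1, hb.2.2.2.2.2, hs.1, hs.2]
  · exfalso
    have hj := r₂_spec.1
    simp only [Set.mem_Ioo] at hj
    rw [h] at hv
    nlinarith [hj.1, hj.2, hb.1, hb.2.1, hb.2.2.1, hb.2.2.2.1, hb.2.2.2.2.1, hb.2.2.2.2.2, hs.1, hs.2]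
  · exfalso
    have hj := r₃_spec.1
    simp only [Set.mem_Ioo] at hj
    rw [h] at hv
    nlinarith [hj.1, hj.2, hb.1, hb.2.1, hb.2.2.1, hb.2.2.2.1, hb.2.2.2.2.1, hb.2.2.2.2.2, hs.1, hs.2]
  · exfalso
    have hj := r₄_spec.1
    simp only [Set.mem_Ioo] at hj
    rw [h] at hv
    nlinarith [hj.1, hj.2, hb.1, hb.2.1, hb.2.2.1, hb.2.2.2.1, hb.2.2.2.2.1, hb.2.2.2.2.2, hs.1, hs.2]


/-- **The permutation of the real places induced by `σ`.** [folklore] -/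
def π : Fin 5 → Fin 5 := ![1, 3, 4, 2, 0]

/-- `r 0 = r₀`, …. [folklore] -/
theorem r_0 : r 0 = r₀ := rfl
/-- `r 1 = r₁`. [folklore] -/
theorem r_1 : r 1 = r₁ := rfl
/-- `r 2 = r₂`. [folklore] -/
theorem r_2 : r 2 = r₂ := rfl
/-- `r 3 = r₃`. [folklore] -/
theorem r_3 : r 3 = r₃ := rfl
/-- `r 4 = r₄`. [folklore] -/
theorem r_4 : r 4 = r₄ := rfl

/-- **`emb s (σθ) = r (π s)`.** [folklore] -/
theorem emb_g_one (s : Fin 5) : emb s (g 1) = r (π s) := by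
  fin_cases s
  · exact emb_g_one_0
  · exact emb_g_one_1
  · exact emb_g_one_2
  · exact emb_g_one_3
  · exact emb_g_one_4

/-- **`emb s ∘ σ = emb (π s)`** (both send `θ ↦ r (π s)`). [folklore] -/
theorem emb_comp_σ (s : Fin 5) : (emb s).comp (σ : K →+* K) = emb (π s) :=
  ringHom_real_ext (by
    change emb s (σ θ) = emb (π s) θ
    rw [σ_θ, emb_g_one, emb_θ])

/-- `emb s (σ x) = emb (π s) x`. [folklore] -/
theorem emb_σ (s : Fin 5) (x : K) : emb s (σ x) = emb (π s) x :=
  DFunLike.congr_fun (emb_comp_σ s) x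

/-- Iterates: `emb s (σᵏ x) = emb (πᵏ s) x`. [folklore] -/
theorem emb_σ_iterate (k : ℕ) (s : Fin 5) (x : K) : emb s (σ^[k] x) = emb (π^[k] s) x := by
  induction k generalizing s x with
  | zero => rfl
  | succ k ih => rw [Function.iterate_succ_apply, Function.iterate_succ_apply', ih, emb_σ]

/-- `emb s (g b) = r (πᵇ s)`. [folklore] -/
theorem emb_g (s b : Fin 5) : emb s (g b) = r (π^[(b : ℕ)] s) := by
  rw [← σ_iterate_θ, emb_σ_iterate, emb_θ]

/-- **`emb s (Σ y_b g_b) = Σ y_b r_(πᵇ s)`.** [folklore] -/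
theorem emb_liftK (s : Fin 5) (y : R) : emb s (liftK y) = ∑ b, (y.coef b : ℝ) * r (π^[(b : ℕ)] s) := by
  rw [liftK, TableSpec.lift_apply, map_sum]
  refine Finset.sum_congr rfl fun b _ => ?_
  rw [map_mul, map_intCast, emb_g]

/-- The conjugates `shiftⁱ v` (computed externally, verified below). [folklore] -/
def shiftTab : Fin 5 → R := ![⟨![-349, -315, -316, -333, -327]⟩, ⟨![-327, -349, -315, -316, -333]⟩, ⟨![-333, -327, -349, -315, -316]⟩, ⟨![-316, -333, -327, -349, -315]⟩, ⟨![-315, -316, -333, -327, -349]⟩]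

/-- `shiftⁱ v = shiftTab i` (kernel computation). [folklore] -/
theorem shift_iterate_vP : ∀ i : Fin 5, shift^[(i : ℕ)] vP = shiftTab i := by
  decide +kernel

/-- **`∏ₛ emb s z = N(z)`**: the norm is the product over the real places. [folklore] -/
theorem prod_emb_eq_norm (z : K) : ∏ s : Fin 5, emb s z = Algebra.norm ℚ z := by
  have h := congrArg (emb 0) (norm_eq_prod_pow_σ z)
  rw [map_prod] at h
  have h' : (emb 0) (algebraMap ℚ K (Algebra.norm ℚ z)) = (Algebra.norm ℚ z : ℝ) := by
    rw [← RingHom.comp_apply, RingHom.ext_rat ((emb 0).comp (algebraMap ℚ K)) (algebraMap ℚ ℝ)]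
    rfl
  rw [h'] at h
  rw [h]
  have hperm : ∀ i : Fin 5, emb 0 ((σ ^ (i : ℕ)) z) = emb (π^[(i : ℕ)] 0) z := fun i => by
    rw [σ_pow_apply, emb_σ_iterate]
  simp_rw [hperm]
  symm
  refine Finset.prod_nbij (fun i : Fin 5 => π^[(i : ℕ)] 0) (fun _ _ => Finset.mem_univ _) ?_ ?_ (fun _ _ => rfl)
  · intro i _ i' _ h
    have key : ∀ a b : Fin 5, π^[(a : ℕ)] 0 = π^[(b : ℕ)] 0 → a = b := by decide
    exact key i i' h
  · intro t _
    have key : ∀ t : Fin 5, ∃ i : Fin 5, π^[(i : ℕ)] 0 = t := by decide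
    obtain ⟨i, hi⟩ := key t
    exact ⟨i, Finset.mem_univ _, hi⟩

/-- `emb s v = Σ_b v_b r_(πᵇ s)`. [folklore] -/
theorem emb_vK_eq (s : Fin 5) : emb s (liftK vP) = ∑ b, (vP.coef b : ℝ) * r (π^[(b : ℕ)] s) := emb_liftK s vP

/-- The real signs of `v` (computed externally, verified below). [folklore] -/
def sgnv5 : Fin 5 → SignType := ![-1, -1, 1, 1, -1]

/-- **The signs of `v` at the five real places** (linear interval arithmetic on the roots; a place
where `|emb s v|` is below the precision of the root brackets is recovered from
`∏ₛ emb s v = N(v)`). [folklore] -/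
theorem sign_emb_vK : ∀ s : Fin 5, SignType.sign (emb s (liftK vP)) = sgnv5 s := by
  have h0 := r₀_spec.1; have h1 := r₁_spec.1; have h2 := r₂_spec.1; have h3 := r₃_spec.1
  have h4 := r₄_spec.1
  simp only [Set.mem_Ioo] at h0 h1 h2 h3 h4
  have hev : ∀ s : Fin 5, emb s (liftK vP) = ∑ b, (vP.coef b : ℝ) * r (π^[(b : ℕ)] s) := emb_vK_eq
  have e0 : SignType.sign (emb 0 (liftK vP)) = -1 := by
    have e : emb 0 (liftK vP) = (-349 : ℝ) * r₀ + (-315 : ℝ) * r₁ + (-316 : ℝ) * r₃ + (-333 : ℝ) * r₂ + (-327 : ℝ) * r₄ := by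
      rw [hev, Fin.sum_univ_five]
      simp only [vP, π, Fin.isValue, Matrix.cons_val_zero, Matrix.cons_val_one, Matrix.head_cons, Matrix.cons_val_two,
        Matrix.tail_cons, Matrix.cons_val_three, Matrix.cons_val_four, Function.iterate_succ_apply',
        Function.iterate_zero_apply, Fin.val_zero, Fin.val_one, Fin.val_two, show ((3 : Fin 5) : ℕ) = 3 from rfl,
        show ((4 : Fin 5) : ℕ) = 4 from rfl, r_0, r_1, r_2, r_3, r_4, Int.cast_ofNat, Int.cast_neg]
    rw [e]
    exact sign_neg (by linarith)
  have e1 : SignType.sign (emb 1 (liftK vP)) = -1 := by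
    have e : emb 1 (liftK vP) = (-349 : ℝ) * r₁ + (-315 : ℝ) * r₃ + (-316 : ℝ) * r₂ + (-333 : ℝ) * r₄ + (-327 : ℝ) * r₀ := by
      rw [hev, Fin.sum_univ_five]
      simp only [vP, π, Fin.isValue, Matrix.cons_val_zero, Matrix.cons_val_one, Matrix.head_cons, Matrix.cons_val_two,
        Matrix.tail_cons, Matrix.cons_val_three, Matrix.cons_val_four, Function.iterate_succ_apply',
        Function.iterate_zero_apply, Fin.val_zero, Fin.val_one, Fin.val_two, show ((3 : Fin 5) : ℕ) = 3 from rfl,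
        show ((4 : Fin 5) : ℕ) = 4 from rfl, r_0, r_1, r_2, r_3, r_4, Int.cast_ofNat, Int.cast_neg]
    rw [e]
    exact sign_neg (by linarith)
  have e2 : SignType.sign (emb 2 (liftK vP)) = 1 := by
    have e : emb 2 (liftK vP) = (-349 : ℝ) * r₂ + (-315 : ℝ) * r₄ + (-316 : ℝ) * r₀ + (-333 : ℝ) * r₁ + (-327 : ℝ) * r₃ := by
      rw [hev, Fin.sum_univ_five]
      simp only [vP, π, Fin.isValue, Matrix.cons_val_zero, Matrix.cons_val_one, Matrix.head_cons, Matrix.cons_val_two,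
        Matrix.tail_cons, Matrix.cons_val_three, Matrix.cons_val_four, Function.iterate_succ_apply',
        Function.iterate_zero_apply, Fin.val_zero, Fin.val_one, Fin.val_two, show ((3 : Fin 5) : ℕ) = 3 from rfl,
        show ((4 : Fin 5) : ℕ) = 4 from rfl, r_0, r_1, r_2, r_3, r_4, Int.cast_ofNat, Int.cast_neg]
    rw [e]
    exact sign_pos (by linarith)
  have e3 : SignType.sign (emb 3 (liftK vP)) = 1 := by
    have e : emb 3 (liftK vP) = (-349 : ℝ) * r₃ + (-315 : ℝ) * r₂ + (-316 : ℝ) * r₄ + (-333 : ℝ) * r₀ + (-327 : ℝ) * r₁ := by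
      rw [hev, Fin.sum_univ_five]
      simp only [vP, π, Fin.isValue, Matrix.cons_val_zero, Matrix.cons_val_one, Matrix.head_cons, Matrix.cons_val_two,
        Matrix.tail_cons, Matrix.cons_val_three, Matrix.cons_val_four, Function.iterate_succ_apply',
        Function.iterate_zero_apply, Fin.val_zero, Fin.val_one, Fin.val_two, show ((3 : Fin 5) : ℕ) = 3 from rfl,
        show ((4 : Fin 5) : ℕ) = 4 from rfl, r_0, r_1, r_2, r_3, r_4, Int.cast_ofNat, Int.cast_neg]
    rw [e]
    exact sign_pos (by linarith)
  have e4 : SignType.sign (emb 4 (liftK vP)) = -1 := by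
    have e : emb 4 (liftK vP) = (-349 : ℝ) * r₄ + (-315 : ℝ) * r₀ + (-316 : ℝ) * r₁ + (-333 : ℝ) * r₃ + (-327 : ℝ) * r₂ := by
      rw [hev, Fin.sum_univ_five]
      simp only [vP, π, Fin.isValue, Matrix.cons_val_zero, Matrix.cons_val_one, Matrix.head_cons, Matrix.cons_val_two,
        Matrix.tail_cons, Matrix.cons_val_three, Matrix.cons_val_four, Function.iterate_succ_apply',
        Function.iterate_zero_apply, Fin.val_zero, Fin.val_one, Fin.val_two, show ((3 : Fin 5) : ℕ) = 3 from rfl,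
        show ((4 : Fin 5) : ℕ) = 4 from rfl, r_0, r_1, r_2, r_3, r_4, Int.cast_ofNat, Int.cast_neg]
    rw [e]
    exact sign_neg (by linarith)
  intro s
  fin_cases s
  · exact e0
  · exact e1
  · exact e2
  · exact e3
  · exact e4

/-- `σⁱ v` in `K` is `σⁱ` of `v`. [folklore] -/
theorem coe_unitv_eq (i : Fin 5) : (((unitv i : (𝓞 K)ˣ) : 𝓞 K) : K) = σ^[(i : ℕ)] (liftK vP) := by
  rw [coe_unitv, coe_liftO, σ_iterate_liftK]

/-- The real signs of the conjugate units: `sgnTab i s = sign (emb s (σⁱ v)) = sgnv5 (πⁱ s)`. [folklore] -/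
def sgnTab (i s : Fin 5) : SignType := sgnv5 (π^[(i : ℕ)] s)

/-- **The signs of the conjugate units at the real places.** [folklore] -/
theorem sign_emb_unitv (i s : Fin 5) : SignType.sign (emb s (((unitv i : (𝓞 K)ˣ) : 𝓞 K) : K)) = sgnTab i s := by
  rw [coe_unitv_eq, emb_σ_iterate, sign_emb_vK, sgnTab]

/-- The real sign vector of a field element. [folklore] -/
def sgn5 (z : K) : Fin 5 → SignType := fun s => SignType.sign (emb s z)

/-- `sgn5` is multiplicative. [folklore] -/
theorem sgn5_mul (z z' : K) : sgn5 (z * z') = sgn5 z * sgn5 z' := by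
  ext s; simp [sgn5, sign_mul]

/-- The predicted sign vector of `rep n`. [folklore] -/
def sgnOf (n : Fin 32) (s : Fin 5) : SignType :=
  (-1) ^ bit n 4 * (sgnTab 0 s ^ bit n 0 * sgnTab 1 s ^ bit n 1 * sgnTab 2 s ^ bit n 2 * sgnTab 3 s ^ bit n 3)

/-- **`sgn5 (rep n) = sgnOf n`.** [folklore] -/
theorem sgn5_rep (n : Fin 32) : sgn5 ((((rep n : (𝓞 K)ˣ) : 𝓞 K) : K)) = sgnOf n := by
  ext s
  rw [rep, Units.val_mul, Units.val_pow_eq_pow_val, Units.val_neg, Units.val_one, Units.coe_prod, Fin.prod_univ_four]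
  simp only [Units.val_pow_eq_pow_val, Fin.castSucc_zero, Fin.castSucc_one,
    show (Fin.castSucc (2 : Fin 4) : Fin 5) = 2 from rfl, show (Fin.castSucc (3 : Fin 4) : Fin 5) = 3 from rfl]
  push_cast
  have hs1 : SignType.sign (-1 : ℝ) = -1 := by rw [Left.sign_neg, sign_one]
  simp only [sgn5, sgnOf, map_mul, map_pow, map_neg, map_one, sign_mul, sign_pow, hs1, sign_emb_unitv]

/-- **A totally positive representative is trivial** (the `32` sign vectors are distinct; kernel check
of the positive one). [folklore] -/
theorem rep_eq_zero_of_pos {n : Fin 32} (h : ∀ k, 0 < emb k ((((rep n : (𝓞 K)ˣ) : 𝓞 K) : K))) : n = 0 := by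
  have key : ∀ n : Fin 32, (∀ s, sgnOf n s = 1) → n = 0 := by decide +kernel
  refine key n fun s => ?_
  have := congrFun (sgn5_rep n) s
  rw [← this]
  exact sign_pos (h s)

/-- **`N(σⁱ v) = -1`.** [folklore] -/
theorem norm_unitv (i : Fin 5) : Algebra.norm ℚ ((((unitv i : (𝓞 K)ˣ) : 𝓞 K) : K)) = -1 := by
  rw [coe_unitv, coe_liftO, ← σ_iterate_liftK, ← σ_pow_apply, Algebra.norm_eq_of_algEquiv,
    norm_liftK_of_normT_eq normT_vP]
  norm_num

/-- `N(-1) = -1` (`[K : ℚ] = 5` is odd). [folklore] -/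
theorem norm_neg_one : Algebra.norm ℚ (-1 : K) = -1 := by
  rw [show (-1 : K) = algebraMap ℚ K (-1) by simp, Algebra.norm_algebraMap, finrank_K]; norm_num

/-- **`N(rep n) = (-1 : ℚ) ^ (∑ i, bit n i)`.** [folklore] -/
theorem norm_rep (n : Fin 32) : Algebra.norm ℚ ((((rep n : (𝓞 K)ˣ) : 𝓞 K) : K)) = (-1 : ℚ) ^ (∑ i, bit n i) := by
  rw [rep, Units.val_mul, Units.val_pow_eq_pow_val, Units.val_neg, Units.val_one, Units.coe_prod, Fin.prod_univ_four]
  simp only [Units.val_pow_eq_pow_val, Fin.castSucc_zero, Fin.castSucc_one,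
    show (Fin.castSucc (2 : Fin 4) : Fin 5) = 2 from rfl, show (Fin.castSucc (3 : Fin 4) : Fin 5) = 3 from rfl]
  push_cast
  simp only [map_mul, map_pow, norm_neg_one, norm_unitv]
  rw [Fin.sum_univ_five]; ring

/-! ### Units and valuations -/

/-- The valuation of a unit of `𝓞 K` is `1` at every finite place. [folklore] -/
theorem valuation_coe_unit (v : HeightOneSpectrum (𝓞 K)) (u : (𝓞 K)ˣ) : v.valuation K (((u : 𝓞 K)) : K) = 1 := by
  rw [RingOfIntegers.coe_eq_algebraMap, valuation_of_algebraMap, intValuation_eq_one_iff]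
  exact fun h => v.isPrime.ne_top (Ideal.eq_top_of_isUnit_mem _ h u.isUnit)

/-- A unit of `𝓞 K` is not in the prime `(2)`. [folklore] -/
theorem unit_not_mem_span_two (u : (𝓞 K)ˣ) : ((u : 𝓞 K)) ∉ span {(2 : 𝓞 K)} := fun h =>
  (span_two.1).ne_top (Ideal.eq_top_of_isUnit_mem _ h u.isUnit)
/-- **`K(∅, 2) = 𝓞ˣ/𝓞ˣ² = {rep n}`**: a non-zero `z ∈ K` all of whose valuations are even is `rep n · w²`
(odd class number: the tree's `exists_isSquare_mul_of_two_dvd_log_valuation_of_odd` with `D = 1`; units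
modulo squares: `exists_eq_rep_mul_sq`). [folklore] -/
theorem exists_rep_mul_sq_of_two_dvd_log_valuation {z : K} (hz : z ≠ 0)
    (hval : ∀ v : HeightOneSpectrum (𝓞 K), (2 : ℤ) ∣ WithZero.log (v.valuation K z)) :
    ∃ (n : Fin 32) (w : K), w ≠ 0 ∧ z = (((rep n : (𝓞 K)ˣ) : 𝓞 K) : K) * w ^ 2 := by
  obtain ⟨u, l, hlG, -, r, hr⟩ :=
    Literature.NumberTheory.NumberFields.exists_isSquare_mul_of_two_dvd_log_valuation_of_odd classNumber_odd (1 : 𝓞 K)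
    List.nil (fun v h1 => absurd (v.asIdeal.eq_top_of_isUnit_mem h1 isUnit_one) v.isPrime.ne_top) hz (fun v _ => hval v)
  have hl : l = List.nil := List.eq_nil_iff_forall_not_mem.mpr fun g hg => by simpa using hlG g hg
  subst hl
  simp only [List.prod_nil] at hr
  rw [show (((1 : 𝓞 K)) : K) = 1 from rfl, mul_one] at hr
  -- `z u = r²`, `u⁻¹ = rep n η²`
  obtain ⟨n, η, hu⟩ := exists_eq_rep_mul_sq u⁻¹
  have hu' : (((u⁻¹ : (𝓞 K)ˣ) : 𝓞 K) : K) = (((rep n : (𝓞 K)ˣ) : 𝓞 K) : K) * ((((η : (𝓞 K)ˣ) : 𝓞 K) : K)) ^ 2 := by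
    rw [hu]; simp only [Units.val_mul, Units.val_pow_eq_pow_val]; push_cast; ring
  have huu : (((u : (𝓞 K)ˣ) : 𝓞 K) : K) * (((u⁻¹ : (𝓞 K)ˣ) : 𝓞 K) : K) = 1 := by
    have h1 : ((((u * u⁻¹ : (𝓞 K)ˣ)) : 𝓞 K) : K) = 1 := by rw [mul_inv_cancel]; rfl
    push_cast at h1
    exact h1
  refine ⟨n, (((η : (𝓞 K)ˣ) : 𝓞 K) : K) * r, ?_, ?_⟩
  · intro h0
    apply hz
    have : z * (((u : (𝓞 K)ˣ) : 𝓞 K) : K) = 0 := by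
      rw [hr]
      rcases mul_eq_zero.mp h0 with h | h
      · exfalso
        exact (RingOfIntegers.coe_ne_zero_iff.mpr (Units.ne_zero η)) h
      · rw [h, mul_zero]
    rcases mul_eq_zero.mp this with h | h
    · exact h
    · exact absurd h (RingOfIntegers.coe_ne_zero_iff.mpr (Units.ne_zero u))
  · calc z = z * ((((u : (𝓞 K)ˣ) : 𝓞 K) : K) * (((u⁻¹ : (𝓞 K)ˣ) : 𝓞 K) : K)) := by rw [huu, mul_one]
      _ = (z * (((u : (𝓞 K)ˣ) : 𝓞 K) : K)) * (((u⁻¹ : (𝓞 K)ˣ) : 𝓞 K) : K) := by ring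
      _ = _ := by rw [hr, hu']; ring

/-! ### The curve `480a1 : y² = x(x + 2)(x - 3)` over `K`: even valuations -/

section Curve

variable {x y : K} (hE : y ^ 2 = x * (x + 2) * (x - 3)) (hy : y ≠ 0)
include hE hy

/-- `x ≠ 0`, `x + 2 ≠ 0`, `x - 3 ≠ 0` for a point with `y ≠ 0`. [folklore] -/
theorem x_ne : x ≠ 0 ∧ x + 2 ≠ 0 ∧ x - 3 ≠ 0 := by
  have h : x * (x + 2) * (x - 3) ≠ 0 := by rw [← hE]; exact pow_ne_zero 2 hy
  exact ⟨fun h0 => h (by rw [h0]; ring), fun h0 => h (by rw [h0]; ring), fun h0 => h (by rw [h0]; ring)⟩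

/-- **`ord_v(x)` is even for every finite place `v`**: off `2, 3` by the valuation parity lemma of
the `2`-descent (`Valuation.two_dvd_log_map_sub_of_sq_eq`, `e = (0, -2, 3)`), and at the inert primes
`(2)`, `(3)` by the norm condition `N(x) = □`. [folklore] -/
theorem two_dvd_log_valuation_x (hN : IsSquare (Algebra.norm ℚ x)) (v : HeightOneSpectrum (𝓞 K)) :
    (2 : ℤ) ∣ WithZero.log (v.valuation K x) := by
  obtain ⟨hx0, -, -⟩ := x_ne hE hy
  by_cases h2 : (2 : 𝓞 K) ∈ v.asIdeal
  · rw [eq_v₂_of_mem h2]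
    exact two_dvd_log_valuation_of_isSquare_norm v₂ (p := 2) (by simp [v₂]) hx0 hN
  by_cases h3 : (3 : 𝓞 K) ∈ v.asIdeal
  · rw [eq_v₃_of_mem h3]
    exact two_dvd_log_valuation_of_isSquare_norm v₃ (p := 3) (by simp [v₃]) hx0 hN
  have hv2 : v.valuation K (2 : K) = 1 := by exact_mod_cast (valuation_natCast_eq_one_iff v 2).mpr (by exact_mod_cast h2)
  have hv3 : v.valuation K (3 : K) = 1 := by exact_mod_cast (valuation_natCast_eq_one_iff v 3).mpr (by exact_mod_cast h3)
  have key := (v.valuation K).two_dvd_log_map_sub_of_sq_eq (e₁ := 0) (e₂ := -2) (e₃ := 3) (x := x) (y := y)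
    (by rw [map_zero]; exact zero_le_one) (by simp only [Valuation.map_neg, hv2, le_refl]) (by rw [hv3])
    (by simp only [zero_sub, Valuation.map_neg, hv2]) (by simp only [zero_sub, Valuation.map_neg, hv3]) hx0
    (by rw [hE]; ring)
  rwa [sub_zero] at key

/-- **`ord_v(x + 2)` is even for every finite place `v`**: off `2, 5` by the parity lemma
(`e = (-2, 0, 3)`), at the inert primes `(2)`, `(5)` by `N(x + 2) = □`. [folklore] -/
theorem two_dvd_log_valuation_x_add_two (hN : IsSquare (Algebra.norm ℚ (x + 2))) (v : HeightOneSpectrum (𝓞 K)) :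
    (2 : ℤ) ∣ WithZero.log (v.valuation K (x + 2)) := by
  obtain ⟨hx0, hx2, -⟩ := x_ne hE hy
  by_cases h2 : (2 : 𝓞 K) ∈ v.asIdeal
  · rw [eq_v₂_of_mem h2]
    exact two_dvd_log_valuation_of_isSquare_norm v₂ (p := 2) (by simp [v₂]) hx2 hN
  by_cases h5 : (5 : 𝓞 K) ∈ v.asIdeal
  · rw [eq_v₅_of_mem h5]
    exact two_dvd_log_valuation_of_isSquare_norm v₅ (p := 5) (by simp [v₅]) hx2 hN
  have hv2 : v.valuation K (2 : K) = 1 := by exact_mod_cast (valuation_natCast_eq_one_iff v 2).mpr (by exact_mod_cast h2)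
  have hv5 : v.valuation K (5 : K) = 1 := by exact_mod_cast (valuation_natCast_eq_one_iff v 5).mpr (by exact_mod_cast h5)
  have hv3 : v.valuation K (3 : K) ≤ 1 := by exact_mod_cast valuation_natCast_le_one v 3
  have key := (v.valuation K).two_dvd_log_map_sub_of_sq_eq (e₁ := -2) (e₂ := 0) (e₃ := 3) (x := x) (y := y)
    (by simp only [Valuation.map_neg, hv2, le_refl]) (by rw [map_zero]; exact zero_le_one) hv3
    (by simp only [sub_zero, Valuation.map_neg, hv2])
    (by rw [show (-2 : K) - 3 = -5 by norm_num]; simp only [Valuation.map_neg, hv5])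
    (by rw [Ne, ← sub_eq_zero, sub_neg_eq_add]; exact hx2) (by rw [hE]; ring)
  rwa [sub_neg_eq_add] at key
/-- **`x = u A²` with `u = rep n` of norm `+1`**. [folklore] -/
theorem exists_rep_mul_sq_x (hN : IsSquare (Algebra.norm ℚ x)) :
    ∃ (n : Fin 32) (A : K), A ≠ 0 ∧ x = (((rep n : (𝓞 K)ˣ) : 𝓞 K) : K) * A ^ 2 ∧
      2 ∣ bit n 0 + bit n 1 + bit n 2 + bit n 3 + bit n 4 := by
  obtain ⟨hx0, -, -⟩ := x_ne hE hy
  obtain ⟨n, A, hA, hxA⟩ := exists_rep_mul_sq_of_two_dvd_log_valuation hx0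
    (two_dvd_log_valuation_x hE hy hN)
  refine ⟨n, A, hA, hxA, ?_⟩
  rw [← sum_bit_eq]
  have hNx : Algebra.norm ℚ x = (-1) ^ (∑ i, bit n i) * (Algebra.norm ℚ A) ^ 2 := by
    rw [hxA, map_mul, map_pow, norm_rep]
  have hq : Algebra.norm ℚ A ≠ 0 := Algebra.norm_ne_zero_iff.mpr hA
  by_contra hodd
  rw [(Nat.not_even_iff_odd.mp (fun h => hodd (even_iff_two_dvd.mp h))).neg_one_pow] at hNx
  have hlt : Algebra.norm ℚ x < 0 := by rw [hNx]; nlinarith [sq_pos_iff.mpr hq]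
  linarith [hN.nonneg]

/-- **`x + 2 = B²`**: `x + 2 = u' B²` with a unit representative `u' = rep n'` (even valuations,
odd class number), and `x + 2` is positive at all five real places, so `u'` is totally positive, so `n' = 0`.
[folklore] -/
theorem x_add_two_eq_sq (hN : IsSquare (Algebra.norm ℚ (x + 2))) : ∃ B : K, B ≠ 0 ∧ x + 2 = B ^ 2 := by
  obtain ⟨-, hx2, -⟩ := x_ne hE hy
  obtain ⟨n, B, hB, hxB⟩ := exists_rep_mul_sq_of_two_dvd_log_valuation hx2
    (two_dvd_log_valuation_x_add_two hE hy hN)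
  have hn : n = 0 := by
    refine rep_eq_zero_of_pos fun k => ?_
    have hpos := emb_x_add_two_pos hE hy k
    rw [hxB, map_mul, map_pow] at hpos
    have hB2 : 0 < (emb k B) ^ 2 := lt_of_le_of_ne (sq_nonneg _) (Ne.symm (pow_ne_zero 2 ((_root_.map_ne_zero _).mpr hB)))
    exact (mul_pos_iff_of_pos_right hB2).mp hpos
  subst hn
  refine ⟨B, hB, ?_⟩
  rw [hxB, rep_zero]; simp

end Curve

/-! ### The `2`-adic obstruction: reduction to `𝓞/4` -/

section TwoAdic

/-- An element of `𝓞 K` outside `(2)` has odd image in `𝓞/4`. [folklore] -/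
theorem isOdd_of_not_mem {z : 𝓞 K} (hz : z ∉ span {(2 : 𝓞 K)}) : IsOdd (red4 z) :=
  isOdd_of_not_two_dvd (by rwa [Ideal.mem_span_singleton] at hz)

/-- **Core of case `ord₂(x) = 0`.** If `α u² + 2e² = w²` and `α u² - 3e² = α c²` in `𝓞 K` with
`u, w ∉ (2)`, `red4(e)² = 1` and `red4 α = repQ n` a candidate, contradiction (`no_solution_main`). [folklore] -/
theorem core_main {αO u w c e : 𝓞 K} {n : Fin 32} (hn : n ∈ candN) (hα : red4 αO = repQ n)
    (hu : u ∉ span {(2 : 𝓞 K)}) (hw : w ∉ span {(2 : 𝓞 K)}) (he : red4 e * red4 e = 1)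
    (h1 : αO * u ^ 2 + 2 * e ^ 2 = w ^ 2) (h2 : αO * u ^ 2 - 3 * e ^ 2 = αO * c ^ 2) : False := by
  have e1 := congrArg red4 h1
  have e2 := congrArg red4 h2
  simp only [map_add, map_sub, map_mul, map_ofNat, pow_two, he, mul_one, hα] at e1 e2
  exact no_solution_main hn (sq_mem_oddSq4 _ (isOdd_of_not_mem hu)) (sq_mem_oddSq4 _ (isOdd_of_not_mem hw))
    (sq_mem_sq4 (red4 c)) e1 e2

/-- **Core of case `ord₂(x) < 0`**: `α u² + 2·4^M e² = w²` (`M ≥ 1`) with `u, w ∉ (2)` and `red4 α` a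
candidate: contradiction (`no_solution_neg`; `4^M = 0` in `𝓞/4`). [folklore] -/
theorem core_neg {αO u w e : 𝓞 K} {n : Fin 32} (hn : n ∈ candN) (hα : red4 αO = repQ n)
    (hu : u ∉ span {(2 : 𝓞 K)}) (hw : w ∉ span {(2 : 𝓞 K)}) {M : ℕ} (hM : 1 ≤ M)
    (h1 : αO * u ^ 2 + 2 * 4 ^ M * e ^ 2 = w ^ 2) : False := by
  have e1 := congrArg red4 h1
  have h4M : (4 : Q4) ^ M = 0 := by
    obtain ⟨m, rfl⟩ := Nat.exists_eq_add_of_le hM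
    rw [pow_add, pow_one, four_eq_zero, zero_mul]
  simp only [map_add, map_mul, map_pow, map_ofNat, pow_two, h4M, mul_zero, zero_mul, add_zero, hα] at e1
  exact no_solution_neg hn (sq_mem_oddSq4 _ (isOdd_of_not_mem hu)) (sq_mem_oddSq4 _ (isOdd_of_not_mem hw)) e1

/-- An odd rational integer is not in `(2) ⊂ 𝓞 K` (reduce `d = 2e` modulo `2` via `red42 ∘ red4`).
[folklore] -/
theorem intCast_not_mem_span_two {d : ℤ} (hd : Odd d) :
    ((d : ℤ) : 𝓞 K) ∉ span {(2 : 𝓞 K)} := by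
  intro hmem
  rw [Ideal.mem_span_singleton] at hmem
  obtain ⟨e, he⟩ := hmem
  obtain ⟨k, rfl⟩ := hd
  have h := congrArg (red42.comp red4) he
  simp only [RingHom.comp_apply, map_intCast, map_mul, map_ofNat] at h
  have h2 : (2 : Q2) = 0 := by decide +kernel
  rw [h2, zero_mul] at h
  have h1 : ((2 * k + 1 : ℤ) : Q2) = 1 := by
    push_cast
    rw [h2, zero_mul, zero_add]
  rw [h1] at h
  exact absurd h (by decide +kernel)

/-- For an odd integer `d`, `red4(d)² = 1` in `𝓞/4` (`(2k+1)² = 4(k² + k) + 1 ≡ 1 (mod 4)`). [folklore] -/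
theorem ψ_intCast_sq_eq_one {d : ℤ} (hd : Odd d) : red4 (d : 𝓞 K) * red4 (d : 𝓞 K) = 1 := by
  obtain ⟨k, rfl⟩ := hd
  rw [map_intCast]
  have e : ((2 * k + 1 : ℤ) : Q4) * ((2 * k + 1 : ℤ) : Q4) = 4 * ((k * k + k : ℤ) : Q4) + 1 := by
    push_cast; ring
  rw [e, four_eq_zero, zero_mul, zero_add]

/-- `σint` preserves non-membership in `(2)`. [folklore] -/
theorem σint_not_mem_span_two {s : 𝓞 K} (hs : s ∉ span {(2 : 𝓞 K)}) : σint s ∉ span {(2 : 𝓞 K)} := by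
  have hv2 : v₂.asIdeal = span {((2 : ℕ) : 𝓞 K)} := by simp [v₂]
  have h1 : v₂.intValuation (σint s) = v₂.intValuation s := intValuation_ringEquiv_eq v₂ hv2 σint s
  intro hmem
  apply hs
  have : v₂.intValuation (σint s) < 1 := (intValuation_lt_one_iff_mem _ _).mpr hmem
  rw [h1] at this
  exact (intValuation_lt_one_iff_mem _ _).mp this

/-- The norm of `s ∈ 𝓞 K` as an element of `𝓞 K`: `N(s) = ∏_{i<5} σⁱ s`. [folklore] -/
theorem intCast_norm_eq (s : 𝓞 K) :
    ((Algebra.norm ℤ s : ℤ) : 𝓞 K) =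
      s * σint s * σint (σint s) * σint (σint (σint s)) * σint (σint (σint (σint s))) := by
  apply RingOfIntegers.coe_injective
  have h := norm_eq_prod_pow_σ (s : K)
  rw [Fin.prod_univ_five] at h
  simp only [σ_pow_apply, Fin.val_zero, Fin.val_one, Fin.val_two, show ((3 : Fin 5) : ℕ) = 3 from rfl,
    show ((4 : Fin 5) : ℕ) = 4 from rfl, Function.iterate_succ_apply', Function.iterate_zero_apply] at h
  rw [← Algebra.coe_norm_int s, eq_ratCast, Rat.cast_intCast] at h
  calc (((Algebra.norm ℤ s : ℤ) : 𝓞 K) : K) = ((Algebra.norm ℤ s : ℤ) : K) := by rfl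
    _ = (s : K) * σ (s : K) * σ (σ (s : K)) * σ (σ (σ (s : K))) * σ (σ (σ (σ (s : K)))) := h
    _ = ((s * σint s * σint (σint s) * σint (σint (σint s)) * σint (σint (σint (σint s))) : 𝓞 K) : K) := by
        push_cast
        simp only [coe_σint]

/-- A product of two elements outside the prime `(2)` is outside `(2)`. [folklore] -/
theorem mul_not_mem_span_two {a b : 𝓞 K} (ha : a ∉ span {(2 : 𝓞 K)}) (hb : b ∉ span {(2 : 𝓞 K)}) :
    a * b ∉ span {(2 : 𝓞 K)} := fun h => by
  rcases (span_two.1.isPrime).mem_or_mem h with h1 | h2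
  · exact ha h1
  · exact hb h2

/-- **`2`-adic units of `K` have odd integral denominators.** If `v₂(z) ≤ 1` then `z · d = w` for some
`w ∈ 𝓞 K` and some ODD `d ∈ ℤ`, and `w ∉ (2)` when `v₂(z) = 1`: write `z = n/s` with `s ∉ (2)` and take
`d = N(s) = ∏ σⁱ s`, odd because `(2)` is a `σ`-stable prime. [folklore] -/
theorem exists_odd_int_mul_eq {z : K} (hz : v₂.valuation K z ≤ 1) :
    ∃ (w : 𝓞 K) (d : ℤ), Odd d ∧ z * (d : K) = (w : K) ∧ (v₂.valuation K z = 1 → w ∉ span {(2 : 𝓞 K)}) := by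
  obtain ⟨n, s, hns⟩ := exists_primeCompl_mul_eq_of_integer v₂ z hz
  have hs : (s : 𝓞 K) ∉ span {(2 : 𝓞 K)} := s.2
  haveI := span_two.1.isPrime
  set c : 𝓞 K := σint s * σint (σint s) * σint (σint (σint s)) * σint (σint (σint (σint s))) with hc
  have hs1 := σint_not_mem_span_two hs
  have hs2 := σint_not_mem_span_two hs1
  have hs3 := σint_not_mem_span_two hs2
  have hs4 := σint_not_mem_span_two hs3
  have hcnot : c ∉ span {(2 : 𝓞 K)} :=
    mul_not_mem_span_two (mul_not_mem_span_two (mul_not_mem_span_two hs1 hs2) hs3) hs4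
  set d : ℤ := Algebra.norm ℤ (s : 𝓞 K) with hd
  have hdO : (d : 𝓞 K) = s * c := by rw [hc, intCast_norm_eq]; ring
  have hdnot : (d : 𝓞 K) ∉ span {(2 : 𝓞 K)} := by rw [hdO]; exact mul_not_mem_span_two hs hcnot
  have hodd : Odd d := by
    rw [← Int.not_even_iff_odd]
    rintro ⟨k, hk⟩
    apply hdnot
    rw [Ideal.mem_span_singleton]
    exact ⟨k, by rw [hk]; push_cast; ring⟩
  refine ⟨n * c, d, hodd, ?_, fun hz1 => ?_⟩
  · have e : (d : K) = (((d : 𝓞 K)) : K) := by rfl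
    rw [e, hdO]
    push_cast
    have hns' : z * ((s : 𝓞 K) : K) = (n : K) := hns
    linear_combination ((c : 𝓞 K) : K) * hns'
  · intro hmem
    rcases (span_two.1.isPrime).mem_or_mem hmem with h1 | h2
    · have hvs : v₂.valuation K ((s : 𝓞 K) : K) = 1 := by
        rw [show ((s : 𝓞 K) : K) = algebraMap (𝓞 K) K s from rfl, valuation_of_algebraMap, intValuation_eq_one_iff]
        exact hs
      have hvn : v₂.valuation K ((n : 𝓞 K) : K) < 1 := by
        rw [show ((n : 𝓞 K) : K) = algebraMap (𝓞 K) K n from rfl, valuation_lt_one_iff_mem]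
        exact h1
      have : v₂.valuation K (z * ((s : 𝓞 K) : K)) = 1 := by rw [map_mul, hz1, hvs, mul_one]
      rw [show z * ((s : 𝓞 K) : K) = ((n : 𝓞 K) : K) from hns] at this
      exact absurd this hvn.ne
    · exact hcnot h2

/-- `v₂(2) = exp(-1)` (`(2)` is prime, so `2` is a uniformizer). [folklore] -/
theorem valuation_v₂_two : v₂.valuation K (2 : K) = WithZero.exp (-1) := by
  rw [← map_ofNat (algebraMap (𝓞 K) K) 2, valuation_of_algebraMap, v₂.intValuation_singleton (by norm_num) rfl]

/-- In `ℤᵐ⁰`, `log a ≤ 0 ↔ a ≤ 1` for `a ≠ 0`. [folklore] -/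
theorem log_nonpos_iff {a : ℤᵐ⁰} (ha : a ≠ 0) : WithZero.log a ≤ 0 ↔ a ≤ 1 := by
  rw [← WithZero.log_one]; exact WithZero.log_le_log ha one_ne_zero

/-- **The `2`-adic obstruction.** Let `α ∈ 𝓞 K ∖ (2)` with `red4 α = repQ n` one of the fifteen
candidates, and suppose `x = α A²`, `x + 2 = B²` (`A, B ∈ Kˣ`) for a point `(x, y)`, `y ≠ 0`, of
`y² = x(x+2)(x-3)`. This is impossible: with `x - 3 = α C²`, `C = y/(αAB)`, according to
`ord₂(A) > 0`, `= 0`, `= -M < 0` one gets `ord₂(x + 2) = 1` odd, resp. the congruences of `core_main`,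
resp. `core_neg` modulo `4`, after clearing odd integral denominators (`exists_odd_int_mul_eq`).
[folklore] -/
theorem two_adic_obstruction {αO : 𝓞 K} (hα : αO ∉ span {(2 : 𝓞 K)}) {n : Fin 32} (hn : n ∈ candN)
    (hαψ : red4 αO = repQ n) {x y A B : K} (hE : y ^ 2 = x * (x + 2) * (x - 3)) (hy : y ≠ 0) (hA : A ≠ 0)
    (hB : B ≠ 0) (hxA : x = (αO : K) * A ^ 2) (hxB : x + 2 = B ^ 2) : False := by
  set v := v₂.valuation K with hv
  have hv2 : v 2 = WithZero.exp (-1) := valuation_v₂_two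
  have hv3 : v (3 : K) ≤ 1 := by exact_mod_cast valuation_natCast_le_one v₂ 3
  have hvα : v (αO : K) = 1 := by
    rw [hv, RingOfIntegers.coe_eq_algebraMap, valuation_of_algebraMap, intValuation_eq_one_iff]; exact hα
  have hα0 : ((αO : 𝓞 K) : K) ≠ 0 := fun h0 => by rw [h0, map_zero] at hvα; exact zero_ne_one hvα
  obtain ⟨hx0, hx2, hx3⟩ := x_ne hE hy
  -- the third coordinate `x - 3 = α C²`
  set C : K := y / (((αO : 𝓞 K) : K) * A * B) with hC
  have hden : ((αO : 𝓞 K) : K) * A * B ≠ 0 := mul_ne_zero (mul_ne_zero hα0 hA) hB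
  have hC0 : C ≠ 0 := div_ne_zero hy hden
  have key : y ^ 2 = (((αO : 𝓞 K) : K) * A ^ 2) * B ^ 2 * (x - 3) := by
    rw [← hxA, ← hxB]; exact hE
  have hxC : x - 3 = ((αO : 𝓞 K) : K) * C ^ 2 := by
    have hprod : ((αO : 𝓞 K) : K) * A ^ 2 * B ^ 2 ≠ 0 :=
      mul_ne_zero (mul_ne_zero hα0 (pow_ne_zero 2 hA)) (pow_ne_zero 2 hB)
    have hx3' : x - 3 = y ^ 2 / (((αO : 𝓞 K) : K) * A ^ 2 * B ^ 2) := by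
      rw [key, mul_div_cancel_left₀ _ hprod]
    rw [hx3', hC, div_pow]
    field_simp
  have hvA0 : v A ≠ 0 := (Valuation.ne_zero_iff v).mpr hA
  have hvB0 : v B ≠ 0 := (Valuation.ne_zero_iff v).mpr hB
  have hvC0 : v C ≠ 0 := (Valuation.ne_zero_iff v).mpr hC0
  have hlx2 : WithZero.log (v (x + 2)) = 2 * WithZero.log (v B) := by
    rw [hxB, map_pow, WithZero.log_pow, nsmul_eq_mul]; push_cast; ring
  have hlx3 : WithZero.log (v (x - 3)) = 2 * WithZero.log (v C) := by
    rw [hxC, map_mul, map_pow, hvα, one_mul, WithZero.log_pow, nsmul_eq_mul]; push_cast; ring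
  have hlx : WithZero.log (v x) = 2 * WithZero.log (v A) := by
    rw [hxA, map_mul, map_pow, hvα, one_mul, WithZero.log_pow, nsmul_eq_mul]; push_cast; ring
  have hvx0 : v x ≠ 0 := (Valuation.ne_zero_iff v).mpr hx0
  have hvx30 : v (x - 3) ≠ 0 := (Valuation.ne_zero_iff v).mpr hx3
  have hxB' : ((αO : 𝓞 K) : K) * A ^ 2 + 2 = B ^ 2 := by rw [← hxA]; exact hxB
  have hxC' : ((αO : 𝓞 K) : K) * A ^ 2 - 3 = ((αO : 𝓞 K) : K) * C ^ 2 := by rw [← hxA]; exact hxC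
  rcases lt_trichotomy (WithZero.log (v A)) 0 with hlt | heq | hgt
  · -- `ord₂ A ≥ 1`: `v x ≤ exp(-2) < v 2`, so `v(x + 2) = v 2` has odd log
    have hvx : v x < v 2 := by
      rw [← WithZero.exp_log hvx0, hlx, hv2, WithZero.exp_lt_exp]; omega
    have h := congrArg WithZero.log (v.map_add_eq_of_lt_right hvx)
    rw [hlx2, hv2, WithZero.log_exp] at h
    omega
  · -- `ord₂ A = 0`
    have hvA : v A = 1 := by rw [← WithZero.exp_log hvA0, heq, WithZero.exp_zero]
    have hvx : v x = 1 := by rw [← WithZero.exp_log hvx0, hlx, heq, mul_zero, WithZero.exp_zero]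
    have hvx2 : v (x + 2) = 1 := by
      rw [v.map_add_eq_of_lt_left (by rw [hvx, hv2, ← WithZero.exp_zero, WithZero.exp_lt_exp]; norm_num)]
      exact hvx
    have hvB : v B = 1 := by
      have h := congrArg WithZero.log hvx2
      rw [hlx2, WithZero.log_one] at h
      rw [← WithZero.exp_log hvB0, show WithZero.log (v B) = 0 by omega, WithZero.exp_zero]
    have hvx3 : v (x - 3) ≤ 1 := v.map_sub_le hvx.le hv3
    have hvC : v C ≤ 1 := by
      have h := (log_nonpos_iff hvx30).mpr hvx3
      rw [hlx3] at h
      exact (log_nonpos_iff hvC0).mp (by omega)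
    obtain ⟨A₁, dA, hdA, hAd, hA₁⟩ := exists_odd_int_mul_eq hvA.le
    obtain ⟨B₁, dB, hdB, hBd, hB₁⟩ := exists_odd_int_mul_eq hvB.le
    obtain ⟨C₁, dC, hdC, hCd, -⟩ := exists_odd_int_mul_eq hvC
    have hA₁' := hA₁ hvA
    have hB₁' := hB₁ hvB
    have hAd' : A * (dA : K) = algebraMap (𝓞 K) K A₁ := hAd
    have hBd' : B * (dB : K) = algebraMap (𝓞 K) K B₁ := hBd
    have hCd' : C * (dC : K) = algebraMap (𝓞 K) K C₁ := hCd
    have hxB'' : algebraMap (𝓞 K) K αO * A ^ 2 + 2 = B ^ 2 := hxB'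
    have hxC'' : algebraMap (𝓞 K) K αO * A ^ 2 - 3 = algebraMap (𝓞 K) K αO * C ^ 2 := hxC'
    have h1O : αO * (A₁ * dB * dC) ^ 2 + 2 * ((dA : 𝓞 K) * dB * dC) ^ 2 = (B₁ * dA * dC) ^ 2 := by
      apply RingOfIntegers.coe_injective
      simp only [map_add, map_mul, map_pow, map_ofNat, map_intCast]
      rw [← hAd', ← hBd']
      linear_combination ((dA : K) * dB * dC) ^ 2 * hxB''
    have h2O : αO * (A₁ * dB * dC) ^ 2 - 3 * ((dA : 𝓞 K) * dB * dC) ^ 2 = αO * (C₁ * dA * dB) ^ 2 := by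
      apply RingOfIntegers.coe_injective
      simp only [map_sub, map_mul, map_pow, map_ofNat, map_intCast]
      rw [← hAd', ← hCd']
      linear_combination ((dA : K) * dB * dC) ^ 2 * hxC''
    have he : red4 ((dA : 𝓞 K) * dB * dC) * red4 ((dA : 𝓞 K) * dB * dC) = 1 := by
      have h := ψ_intCast_sq_eq_one ((hdA.mul hdB).mul hdC)
      push_cast at h
      exact h
    exact core_main hn hαψ
      (mul_not_mem_span_two (mul_not_mem_span_two hA₁' (intCast_not_mem_span_two hdB))
        (intCast_not_mem_span_two hdC))
      (mul_not_mem_span_two (mul_not_mem_span_two hB₁' (intCast_not_mem_span_two hdA))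
        (intCast_not_mem_span_two hdC))
      he h1O h2O
  · -- `ord₂ A = -M < 0`, `M ≥ 1`: rescale `A, B` by `2^M`
    obtain ⟨M, hM⟩ : ∃ M : ℕ, WithZero.log (v A) = M :=
      ⟨(WithZero.log (v A)).toNat, (Int.toNat_of_nonneg hgt.le).symm⟩
    have hM1 : 1 ≤ M := by omega
    have hvx : v x = WithZero.exp (2 * (M : ℤ)) := by rw [← WithZero.exp_log hvx0, hlx, hM]
    have hvx2 : v (x + 2) = v x :=
      v.map_add_eq_of_lt_left (by rw [hvx, hv2, WithZero.exp_lt_exp]; omega)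
    have hlB : WithZero.log (v B) = M := by
      have h := congrArg WithZero.log hvx2; rw [hlx2, hvx, WithZero.log_exp] at h; omega
    have hunit : ∀ Z : K, WithZero.log (v Z) = M → v Z ≠ 0 → v (Z * 2 ^ M) = 1 := by
      intro Z hZ hZ0
      have hne : v (Z * 2 ^ M) ≠ 0 := by
        rw [map_mul, map_pow, hv2]; exact mul_ne_zero hZ0 (pow_ne_zero _ (by simp))
      rw [← WithZero.exp_log hne, ← WithZero.exp_zero]
      congr 1
      rw [map_mul, map_pow, WithZero.log_mul hZ0 (pow_ne_zero _ (by rw [hv2]; simp)), WithZero.log_pow, hv2,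
        WithZero.log_exp, hZ, nsmul_eq_mul]
      ring
    have hvA₀ := hunit A hM hvA0
    have hvB₀ := hunit B hlB hvB0
    obtain ⟨A₁, dA, hdA, hAd, hA₁⟩ := exists_odd_int_mul_eq hvA₀.le
    obtain ⟨B₁, dB, hdB, hBd, hB₁⟩ := exists_odd_int_mul_eq hvB₀.le
    have hA₁' := hA₁ hvA₀
    have hB₁' := hB₁ hvB₀
    have e4 : (4 : K) ^ M = (2 ^ M) ^ 2 := by
      rw [← pow_mul, mul_comm, pow_mul]; norm_num
    have hAd' : A * 2 ^ M * (dA : K) = algebraMap (𝓞 K) K A₁ := hAd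
    have hBd' : B * 2 ^ M * (dB : K) = algebraMap (𝓞 K) K B₁ := hBd
    have hxB'' : algebraMap (𝓞 K) K αO * A ^ 2 + 2 = B ^ 2 := hxB'
    have h1O : αO * (A₁ * dB) ^ 2 + 2 * 4 ^ M * ((dA : 𝓞 K) * dB) ^ 2 = (B₁ * dA) ^ 2 := by
      apply RingOfIntegers.coe_injective
      simp only [map_add, map_mul, map_pow, map_ofNat, map_intCast]
      rw [← hAd', ← hBd', e4]
      linear_combination ((dA : K) * dB * 2 ^ M) ^ 2 * hxB''
    exact core_neg hn hαψ (mul_not_mem_span_two hA₁' (intCast_not_mem_span_two hdB))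
      (mul_not_mem_span_two hB₁' (intCast_not_mem_span_two hdA)) hM1 h1O

end TwoAdic

/-! ### Assembly -/

/-- **The norm-`1` `2`-descent statement for `480a1` over `K`.** For every `K`-point `(x, y)`, `y ≠ 0`,
of `y² = x(x + 2)(x - 3)` such that `N_{K/ℚ}(x)` and `N_{K/ℚ}(x + 2)` are rational squares, `x` and
`x + 2` are squares in `K`. [folklore] -/
theorem normDescent {x y : K} (hE : y ^ 2 = x * (x + 2) * (x - 3)) (hy : y ≠ 0)
    (hNx : IsSquare (Algebra.norm ℚ x)) (hNx2 : IsSquare (Algebra.norm ℚ (x + 2))) :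
    IsSquare x ∧ IsSquare (x + 2) := by
  obtain ⟨B, hB0, hxB⟩ := x_add_two_eq_sq hE hy hNx2
  obtain ⟨n, A, hA0, hxA, hwt⟩ := exists_rep_mul_sq_x hE hy hNx
  have hn : n = 0 := by
    by_contra hne
    exact two_adic_obstruction (unit_not_mem_span_two (rep n)) (mem_candN n hne hwt) (red4_rep n)
      hE hy hA0 hB0 hxA hxB
  subst hn
  rw [rep_zero] at hxA
  refine ⟨⟨A, ?_⟩, ⟨B, by rw [hxB, pow_two]⟩⟩
  rw [hxA]; simp [pow_two]


section Transport

variable {K' : Type*} [Field K'] [Algebra ℚ K']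

/-- `f(z) = z ^ 5 - z ^ 4 - 1060 * z ^ 3 - 7741 * z ^ 2 + 106549 * z + 125531` as the value of `aeval`. [folklore] -/
theorem aeval_quinticPolyRat (z : K') :
    aeval z quinticPolyRat = z ^ 5 - z ^ 4 - 1060 * z ^ 3 - 7741 * z ^ 2 + 106549 * z + 125531 := by
  refine (aeval_map_algebraMap ℚ z quinticPoly).trans ?_
  rw [quinticPoly]
  simp only [map_add, map_sub, map_pow, map_mul, aeval_X, map_ofNat]

/-- **The homomorphism `K = ℚ[X]/(f) → K'`, `θ ↦ θ'`**, for a root `θ'` of `f` in a `ℚ`-algebra `K'`.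
[folklore] -/
def algHomOfRoot {θ' : K'} (h : θ' ^ 5 - θ' ^ 4 - 1060 * θ' ^ 3 - 7741 * θ' ^ 2 + 106549 * θ' + 125531 = 0) :
    K →ₐ[ℚ] K' :=
  AdjoinRoot.liftAlgHom quinticPolyRat (Algebra.ofId ℚ K') θ'
    (show aeval θ' quinticPolyRat = 0 by rw [aeval_quinticPolyRat, h])

/-- `algHomOfRoot h θ = θ'`. [folklore] -/
theorem algHomOfRoot_θ {θ' : K'} (h : θ' ^ 5 - θ' ^ 4 - 1060 * θ' ^ 3 - 7741 * θ' ^ 2 + 106549 * θ' + 125531 = 0) :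
    algHomOfRoot h θ = θ' :=
  AdjoinRoot.liftAlgHom_root _ _ _ _

/-- **`K ≃ₐ[ℚ] K'` for every quintic extension `K'/ℚ` containing a root of `f`**: the homomorphism
`θ ↦ θ'` out of the field `K` is injective, hence bijective by `[K : ℚ] = 5 = [K' : ℚ]`. [folklore] -/
def algEquivOfRoot (h5 : Module.finrank ℚ K' = 5) {θ' : K'}
    (h : θ' ^ 5 - θ' ^ 4 - 1060 * θ' ^ 3 - 7741 * θ' ^ 2 + 106549 * θ' + 125531 = 0) : K ≃ₐ[ℚ] K' :=
  haveI : FiniteDimensional ℚ K' := Module.finite_of_finrank_eq_succ h5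
  AlgEquiv.ofBijective (algHomOfRoot h)
    ⟨(algHomOfRoot h).toRingHom.injective,
     (LinearMap.injective_iff_surjective_of_finrank_eq_finrank (f := (algHomOfRoot h).toLinearMap)
        (by rw [finrank_K, h5])).mp (algHomOfRoot h).toRingHom.injective⟩

/-- `algEquivOfRoot h5 h θ = θ'`. [folklore] -/
theorem algEquivOfRoot_θ (h5 : Module.finrank ℚ K' = 5) {θ' : K'}
    (h : θ' ^ 5 - θ' ^ 4 - 1060 * θ' ^ 3 - 7741 * θ' ^ 2 + 106549 * θ' + 125531 = 0) : algEquivOfRoot h5 h θ = θ' :=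
  algHomOfRoot_θ h

/-- Squares are preserved by ring isomorphisms. [folklore] -/
theorem isSquare_map_of_isSquare (g : K ≃ₐ[ℚ] K') {z : K} (hz : IsSquare z) : IsSquare (g z) := by
  obtain ⟨r, hr⟩ := hz
  exact ⟨g r, by rw [hr, map_mul]⟩

/-- **Transport of `normDescent` along `K ≃ₐ[ℚ] K'`** (the curve equation, the norms `N_{·/ℚ}` and
squareness are invariant under `ℚ`-algebra isomorphisms). [folklore] -/
theorem normDescent_of_algEquiv (g : K ≃ₐ[ℚ] K') {x y : K'} (hE : y ^ 2 = x * (x + 2) * (x - 3))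
    (hy : y ≠ 0) (hNx : IsSquare (Algebra.norm ℚ x)) (hNx2 : IsSquare (Algebra.norm ℚ (x + 2))) :
    IsSquare x ∧ IsSquare (x + 2) := by
  set x₀ := g.symm x with hx₀
  set y₀ := g.symm y with hy₀
  have hx : x = g x₀ := (g.apply_symm_apply x).symm
  have hyy : y = g y₀ := (g.apply_symm_apply y).symm
  have hE₀ : y₀ ^ 2 = x₀ * (x₀ + 2) * (x₀ - 3) := by
    apply g.injective
    rw [map_pow, map_mul, map_mul, map_add, map_sub, map_ofNat, map_ofNat, ← hx, ← hyy, hE]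
  have hy₀' : y₀ ≠ 0 := fun h => hy (by rw [hyy, h, map_zero])
  have hN₀ : Algebra.norm ℚ x₀ = Algebra.norm ℚ x := by
    rw [hx, Algebra.norm_eq_of_algEquiv g x₀]
  have hN₂ : Algebra.norm ℚ (x₀ + 2) = Algebra.norm ℚ (x + 2) := by
    rw [← Algebra.norm_eq_of_algEquiv g (x₀ + 2), map_add, map_ofNat, ← hx]
  obtain ⟨h1, h2⟩ := normDescent hE₀ hy₀' (hN₀ ▸ hNx) (hN₂ ▸ hNx2)
  refine ⟨hx ▸ isSquare_map_of_isSquare g h1, ?_⟩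
  have : x + 2 = g (x₀ + 2) := by rw [map_add, map_ofNat, ← hx]
  rw [this]
  exact isSquare_map_of_isSquare g h2

/-- **The norm-`1` `2`-descent of `480a1` over ANY quintic extension `K'/ℚ` generated by a root of
`f = X ^ 5 - X ^ 4 - 1060 * X ^ 3 - 7741 * X ^ 2 + 106549 * X + 125531`** (`= quinticPoly`, i.e. over any copy of the
conductor-`2651` cyclic quintic field number `3` = `CyclicQuintic2651K3.K`, in whatever form it presents itself —
e.g. as a subfield of `ℚ(ζ₂₆₅₁)`): points `(x, y)`, `y ≠ 0`, of `y² = x(x+2)(x-3)` with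
`N(x)`, `N(x + 2) ∈ ℚ²` have `x`, `x + 2 ∈ K'²`. [folklore] -/
theorem normDescent_of_root (h5 : Module.finrank ℚ K' = 5) {θ' : K'}
    (hθ' : θ' ^ 5 - θ' ^ 4 - 1060 * θ' ^ 3 - 7741 * θ' ^ 2 + 106549 * θ' + 125531 = 0) {x y : K'}
    (hE : y ^ 2 = x * (x + 2) * (x - 3)) (hy : y ≠ 0) (hNx : IsSquare (Algebra.norm ℚ x))
    (hNx2 : IsSquare (Algebra.norm ℚ (x + 2))) : IsSquare x ∧ IsSquare (x + 2) :=
  normDescent_of_algEquiv (algEquivOfRoot h5 hθ') hE hy hNx hNx2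

end Transport
end CyclicQuintic2651K3

end Literature.NumberTheory.NumberFields

end
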